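import Summits.QuantumFields.YangMills.Theorems.BalabanUVNodesN15CovariantLandauPropagatorPair
import Summits.QuantumFields.YangMills.Theorems.BalabanUVNodesN15TwoSpacingGluingCurvedKnitCovariantLandauGlobalRows
import Summits.QuantumFields.YangMills.Theorems.BalabanUVNodesN15TwoSpacingGluingCurvedKnitSmallFieldLaplacianDefect
import HarnessLib
/-!
# N15 = NE2 — dag-n15-a g33, PROGRAMME (P-R)₄ «ALL FOUR ENTRIES OF (3.42) FOR THE (P-R) FAMILY», (R5): THE η-DEFECT OF THE `(ΔG)`-ENTRY (ENTRY 3) OF (3.42) FOR THE (P-R) GLUED PROPAGATORS —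
# Bałaban's WHOLE covariant summand `P = N_L ⊗ 1 − N_V^Q − N_V^R` live (`ΔX_r = 1 − P_rX_r`) — rate-capped, 207b's THREE global Landau rows DISPLAYED (n15-c∕192 `sfq_idef_lap_cvGlued`'s assembly
# at `P_r`: `𝔇 = −(P′_r∘𝔇(X′_r,X_r) + 𝔇(P′_r,P_r)∘X_r)`, `𝔇(P′_r,P_r) = 𝔇(N_L′,N_L) − 𝔇(N_V^Q′,N_V^Q) − 𝔇(N_V^R′,N_V^R)`)
# (dag-n15-a g33, (R5); node N15 = NE2; `--supports stmt-QuantumFields-27366 --as helper`, count-neutral; one theorem; imports (t2) F2, n15-c∕206 (via F2), n15-c∕211, FILE 134)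

WHY.  Entry 3 of (3.42) for a glued family is `𝔇(Δ′G′, ΔG)` with `ΔG = 1 − PG` (dag-n15-a FILE 134; n15-c∕192 for the (P-Q) family from 188 + 191 + 187b).  For the (P-R) family the summand
carries the Landau perturbation `N_V^R` (n15-c∕201): the η-defect of the pair is n15-c∕206 `sfqr_idef_cvGlued` (six `N_V^R` cut rows displayed, rate-capped), the pair's block locality
and inverse identities are (t2) F2 `sfqr_cvGlued_pair_spec` (global rows displayed), and `𝔇(P′,P)` gains the two-grid defect of `N_V^R` — 207b's third row.  THIS FILE = n15-c∕192's
statement and proof text at `P := N_L ⊗ 1 − N_V^Q − N_V^R`, `N_V := N_V^Q + N_V^R`, with: 207b's THREE global rows DISPLAYED at the cap rate `δ_cap` (coarse `ρ_R`, fine `ρ_R`, defect `o_R`),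
read at n15-c∕206's rate through n15-c∕211 §1 `cv_landauRows_of_global` and at F2's rate directly; the fine summand row gains `− N_V^R′` (amplitude `+ρ_R`), `𝔇(P′,P)` gains
`− 𝔇(N_V^R′,N_V^R)` (amplitude `+o_R`); the scale conditions gain `+ρ_R` (F2's shape); the constant gains `min θ_a θ_b` (bounding `ρ_R`) and `r_r + 2`; the bracket is 206's
(`+ (o_R + o_R)`).

THE RESULT ★★ `sfqr_idef_lap_cvGlued (hδcap)`: `∃ ρ > 0, w₀, R₀, θ₀, R₁ > 0, D₃ ≥ 0`, for every index, refinement, trace-form coordinates, skew `A′` in FILE 130's C² window at scale `r_A ≤ 1`,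
Landau letters `ρ_R, o_R ≥ 0` with `S(1+|J⊕J|) + R₁(K+K₁) + ρ_R ≤ R₀`, `R₁(K+K₁) + ρ_R ≤ θ₀`, transporter sizes `K, K₁ ≤ 1`, and the three global `N_V^R` rows at rate `δ_cap`:
`𝔇(Δ′X′_r, ΔX_r) ≤ D₃·((L^k)^{−1∕16} + S(1+|J⊕J|)η + 2R₁(20η + 4λc_Φr_Aη) + (o_R + o_R))·e^{−ρd}`.  Sequel: (R7) the node with entries 0 and 3 constructed.

HONEST FRAMING ∕ LIMITS.  Assembly of LANDED theorems on dag-n15-c's MODEL operator (covariant Laplacian (3.50) ⊗ colour + Bałaban's summand with BOTH the averaging and the Landau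
part covariant), MODEL class ∕ pairing ∕ carriers (doubled-torus cover, global small-field gauge, `Q(U)` = main term (125) of [B7] (124)); the Landau rows are HYPOTHESES (n15-c∕217–223
reduce the one-grid rows to primitive rows, now ALL FOUR FLAT ROWS PROVED; the defect row is displayed); constants crude; the (3.42) entry SHAPE, NOT [Balaban1985BackgroundPropagators] Thm
3.1 ∕ 3.14 as printed and no estimate of Bałaban's; NE2⁺ NOT PRINTED here; N15 of record untouched (DISCHARGED AS CONSUMED, p687738) — no re-pin, no count moved; K3⁸ OPEN; one finite 𝕋⁴
at fixed ε per index — NOT infinite volume ∕ OS ∕ mass gap ∕ Clay.  `set_option maxHeartbeats 3200000 in` = 192's budget.  Restate-immune (no Theses import).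
-/

noncomputable section

open scoped BigOperators Matrix

namespace Summit.QuantumFields.YangMills.BalabanUVNodes.N15.Gluing

open Literature.MathematicalPhysics.QuantumFieldTheory.Balaban1983to89
open Literature.MathematicalPhysics.QuantumFieldTheory.Balaban1983to89.B11SectG (BlockNorm HasMaj hasMaj_comp_exp)
open Literature.MathematicalPhysics.QuantumFieldTheory.Balaban1983to89.T4EtaRateDefect (idef idef_comp idef_sub)
open Literature.MathematicalPhysics.QuantumFieldTheory.Balaban1983to89.T4EtaRateCoeffDefect (pull)
open Literature.MathematicalPhysics.QuantumFieldTheory.Balaban1983to89.B6Prop26Gluing (mulOp mulOp_apply)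
open Literature.MathematicalPhysics.QuantumFieldTheory.Balaban1983to89.B6UnitTorusCarrier (unitTorusGeo unitTorusGeo_dist unitTorusGeo_dist_nonneg triangle254_unitTorusGeo rowSum_unitTorusGeo)
open Literature.MathematicalPhysics.QuantumFieldTheory.Balaban1983to89.B5Prop11Plancherel (Tor fine unitVec)
open Literature.MathematicalPhysics.QuantumFieldTheory.King1986.Torus (blockOf tdistT tdistT_nonneg)
open Literature.Barriers.QuantumFields (traceForm)
open Summit.QuantumFields.YangMills.BalabanUVNodes.N15.BackgroundLayer (covLapM gavgM gaugeLetters_of_mean)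
open Summit.QuantumFields.YangMills.BalabanUVNodes.N15.VectorPiece (bshiftEquiv kingPr kingPrV tensorId hasMaj_tensorId blkFine kingPrV_bshiftEquiv_pow fibre_conn_kingPrV bshiftEquiv_comm)
open Summit.QuantumFields.YangMills.BalabanUVNodes.N15.MatrixSpecies (coordMat basisConst basisConst_nonneg liftBlk liftMap)
open Summit.QuantumFields.YangMills.BalabanUVNodes.N15.TwoGrid (landauRe qvRe qvAdjRe hasMaj_landauRe paramsOf)
open Summit.QuantumFields.YangMills.BalabanUVNodes.N15.CurvedSpecies (gaugePair coordMat_adCLM_transpose_eq_neg_of_conjTranspose exp_smul_unitary_of_conjTranspose)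
open Summit.QuantumFields.YangMills.BalabanUVNodes.N15.CovAvg (holPath hasMaj_nvQ norm_holPath_two_grid_le)
open Literature.NumberTheory.Sieve.SquarefreeSums (exp_sub_one_le_two_mul)

variable {d : ℕ} {L : ℕ} [NeZero L]

section Lap

open scoped Matrix.Norms.L2Operator

set_option maxHeartbeats 3200000 in
/-- ★★ **THE η-DEFECT OF THE `(ΔG)`-ENTRY OF (3.42) FOR THE (P-R) GLUED PROPAGATORS, GIVEN 207b's THREE GLOBAL LANDAU ROWS** (statement in the module docstring; n15-c∕192's assembly at
`P := N_L ⊗ 1 − N_V^Q − N_V^R` over n15-c∕206, (t2) F2, n15-c∕211 §1).  MODEL operator ∕ class ∕ pairing ∕ carriers; the Landau rows are HYPOTHESES; NOT [B9] Thm 3.1 ∕ 3.14 as printed.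
[cite: Balaban1985BackgroundPropagators, Thm 3.1 (3.42) p.397 (entry 3: shape), (3.25)–(3.26) p.395, (3.49) p.399 (shape of the Landau rows), (3.50) p.400, Thm 3.14 pp.426–427 (template); Balaban1985Averaging, (124)–(125) p.36; King1986, Prop. 3.9 (3.73) p.665] -/
theorem sfqr_idef_lap_cvGlued (hL : Odd L ∧ 1 < L) (hL7 : 7 ≤ L) {a : ℝ} (ha : 0 < a) (ι : Type) [Fintype ι] [DecidableEq ι] {δcap : ℝ} (hδcap : 0 < δcap) :
    ∃ ρ w₀ R₀ θ₀ R₁ D₃ : ℝ, 0 < ρ ∧ 0 < R₀ ∧ 0 < θ₀ ∧ 0 < R₁ ∧ 0 ≤ D₃ ∧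
      ∀ (mv kk r : ℕ), 1 ≤ kk → w₀ ≤ ((L ^ mv : ℕ) : ℝ) →
      ∀ {mm : Type} [Fintype mm] [DecidableEq mm] [Nonempty mm] (e : Matrix mm mm ℂ ≃L[ℝ] (ι → ℝ)), (∀ A B : Matrix mm mm ℂ, traceForm A B = e A ⬝ᵥ e B) →
      ∀ (A' : Fin (d + 1) → CvX' d L mv kk r hL → Matrix mm mm ℂ), (∀ μ x', (A' μ x')ᴴ = -A' μ x') →
      ∀ (rA : ℝ), 0 ≤ rA → rA ≤ 1 → (∀ μ x', ‖A' μ x'‖ ≤ rA) →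
        (∀ μ κ x', ‖A' μ (bshiftEquiv (cvM d L mv kk hL) (L ^ r * L ^ kk) κ x') - A' μ x'‖ ≤ rA * ((((L ^ r * L ^ kk : ℕ) : ℝ))⁻¹)) →
        (∀ μ κ x', ‖(A' μ (bshiftEquiv (cvM d L mv kk hL) (L ^ r * L ^ kk) κ x') - A' μ x') -
            (A' μ (bshiftEquiv (cvM d L mv kk hL) (L ^ r * L ^ kk) κ ((bshiftEquiv (cvM d L mv kk hL) (L ^ r * L ^ kk) μ).symm x')) -
              A' μ ((bshiftEquiv (cvM d L mv kk hL) (L ^ r * L ^ kk) μ).symm x'))‖ ≤ rA * ((((L ^ r * L ^ kk : ℕ) : ℝ))⁻¹) * ((((L ^ r * L ^ kk : ℕ) : ℝ))⁻¹)) →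
        2 * ((1 + Fintype.card (Fin (d + 1))) * ((3 + 2 * ((d : ℝ) + 1)) * rA)) ≤ 1 →
      ∀ (ρR oR : ℝ), 0 ≤ ρR → 0 ≤ oR →
        (14 * Real.exp 1 * (1 + Fintype.card (Fin (d + 1))) * basisConst e * ((1 + Fintype.card (Fin (d + 1))) * ((3 + 2 * ((d : ℝ) + 1)) * rA))) * (1 + Fintype.card (Fin (d + 1) ⊕ Fin (d + 1))) + R₁ * (((1 + Fintype.card ι * (@basisConst ι _ (Matrix mm mm ℂ) Matrix.frobeniusNormedAddCommGroup Matrix.frobeniusNormedSpace e * (2 * Real.sqrt (Fintype.card mm)) * (Real.sqrt (Fintype.card mm) * (2 * (rA * ((((L ^ kk : ℕ) : ℝ))⁻¹)))))) ^ ((d + 2) * L ^ kk) - 1) + ((1 + Fintype.card ι * (@basisConst ι _ (Matrix mm mm ℂ) Matrix.frobeniusNormedAddCommGroup Matrix.frobeniusNormedSpace e * (2 * Real.sqrt (Fintype.card mm)) * (Real.sqrt (Fintype.card mm) * (2 * (rA * ((((L ^ r * L ^ kk : ℕ) : ℝ))⁻¹)))))) ^ ((d + 2) * (L ^ r * L ^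 kk)) - 1)) + ρR ≤ R₀ →
        R₁ * (((1 + Fintype.card ι * (@basisConst ι _ (Matrix mm mm ℂ) Matrix.frobeniusNormedAddCommGroup Matrix.frobeniusNormedSpace e * (2 * Real.sqrt (Fintype.card mm)) * (Real.sqrt (Fintype.card mm) * (2 * (rA * ((((L ^ kk : ℕ) : ℝ))⁻¹)))))) ^ ((d + 2) * L ^ kk) - 1) + ((1 + Fintype.card ι * (@basisConst ι _ (Matrix mm mm ℂ) Matrix.frobeniusNormedAddCommGroup Matrix.frobeniusNormedSpace e * (2 * Real.sqrt (Fintype.card mm)) * (Real.sqrt (Fintype.card mm) * (2 * (rA * ((((L ^ r * L ^ kk : ℕ) : ℝ))⁻¹)))))) ^ ((d + 2) * (L ^ r * L ^ kk)) - 1)) + ρR ≤ θ₀ →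
        ((1 + Fintype.card ι * (@basisConst ι _ (Matrix mm mm ℂ) Matrix.frobeniusNormedAddCommGroup Matrix.frobeniusNormedSpace e * (2 * Real.sqrt (Fintype.card mm)) * (Real.sqrt (Fintype.card mm) * (2 * (rA * ((((L ^ kk : ℕ) : ℝ))⁻¹)))))) ^ ((d + 2) * L ^ kk) - 1) ≤ 1 → ((1 + Fintype.card ι * (@basisConst ι _ (Matrix mm mm ℂ) Matrix.frobeniusNormedAddCommGroup Matrix.frobeniusNormedSpace e * (2 * Real.sqrt (Fintype.card mm)) * (Real.sqrt (Fintype.card mm) * (2 * (rA * ((((L ^ r * L ^ kk : ℕ) : ℝ))⁻¹)))))) ^ ((d + 2) * (L ^ r * L ^ kk)) - 1) ≤ 1 →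
        HasMaj (CvNorm d L mv kk hL ι) (CvNorm d L mv kk hL ι) (cvNVr d L mv kk hL a ι e (fun μ x => NormedSpace.exp (((((L ^ kk : ℕ) : ℝ))⁻¹) • gavgM (Matrix mm mm ℂ) (Fin (d + 1)) (kingPrV L kk r (cvM d L mv kk hL)) A' μ x))) (fun y y' => ρR * Real.exp (-(δcap * (unitTorusGeo L kk (cvM d L mv kk hL)).dist y y'))) →
        HasMaj (BlockNorm.ofBlocks (unitTorusGeo L kk (cvM d L mv kk hL)) (liftBlk (cvBlk d L mv kk hL ∘ (kingPrV L kk r (cvM d L mv kk hL))) ι)) (BlockNorm.ofBlocks (unitTorusGeo L kk (cvM d L mv kk hL)) (liftBlk (cvBlk d L mv kk hL ∘ (kingPrV L kk r (cvM d L mv kk hL))) ι)) (cvNVr' d L mv kk r hL a ι e (fun μ x' => NormedSpace.exp (((((L ^ r * L ^ kk : ℕ) : ℝ))⁻¹) • A' μ x'))) (fun y y' => ρR * Real.exp (-(δcap * (unitTorusGeo L kk (cvM d L mv kk hL)).dist y y'))) →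
        HasMaj (CvNorm d L mv kk hL ι) (BlockNorm.ofBlocks (unitTorusGeo L kk (cvM d L mv kk hL)) (liftBlk (cvBlk d L mv kk hL ∘ (kingPrV L kk r (cvM d L mv kk hL))) ι)) (idef (pull (liftMap (kingPrV L kk r (cvM d L mv kk hL)) ι)) (pull (liftMap (kingPrV L kk r (cvM d L mv kk hL)) ι)) (cvNVr' d L mv kk r hL a ι e (fun μ x' => NormedSpace.exp (((((L ^ r * L ^ kk : ℕ) : ℝ))⁻¹) • A' μ x'))) (cvNVr d L mv kk hL a ι e (fun μ x => NormedSpace.exp (((((L ^ kk : ℕ) : ℝ))⁻¹) • gavgM (Matrix mm mm ℂ) (Fin (d + 1)) (kingPrV L kk r (cvM d L mv kk hL)) A' μ x)))) (fun y y' => oR * Real.exp (-(δcap * (unitTorusGeo L kk (cvM d L mv kk hL)).dist y y'))) →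
        HasMaj (CvNorm d L mv kk hL ι) (BlockNorm.ofBlocks (unitTorusGeo L kk (cvM d L mv kk hL)) (liftBlk (cvBlk d L mv kk hL ∘ kingPrV L kk r (cvM d L mv kk hL)) ι)) (idef (pull (liftMap (kingPrV L kk r (cvM d L mv kk hL)) ι)) (pull (liftMap (kingPrV L kk r (cvM d L mv kk hL)) ι)) ((covLapM (bshiftEquiv (cvM d L mv kk hL) (L ^ r * L ^ kk)) ((((L ^ r * L ^ kk : ℕ) : ℝ))⁻¹) (gaugePair (bshiftEquiv (cvM d L mv kk hL) (L ^ r * L ^ kk)) (fun μ x' => coordMat e (ContinuousLinearMap.mulLeftRight ℝ (Matrix mm mm ℂ) (NormedSpace.exp (((((L ^ r * L ^ kk : ℕ) : ℝ))⁻¹) • A' μ x')) (NormedSpace.exp (((((L ^ r * L ^ kk : ℕ) : ℝ))⁻¹) • A' μ x'))ᴴ)))) ∘ₗ (cvGlued' d L mv kk r hL a ((((L ^ r * L ^ kk : ℕ) : ℝ))⁻¹) ι e (fun _ _ => (1 : Matrix mm mm ℂ)) (fun μ x' => NormedSpace.exp (((((L ^ r * L ^ kk : ℕ) : ℝ))⁻¹)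 • A' μ x')) (cvNL' d L mv kk r hL a ι - (cvNVq' d L mv kk r hL a ι e (fun μ x' => NormedSpace.exp (((((L ^ r * L ^ kk : ℕ) : ℝ))⁻¹) • A' μ x'))) - (cvNVr' d L mv kk r hL a ι e (fun μ x' => NormedSpace.exp (((((L ^ r * L ^ kk : ℕ) : ℝ))⁻¹) • A' μ x')))) (fun _ => (cvNVq' d L mv kk r hL a ι e (fun μ x' => NormedSpace.exp (((((L ^ r * L ^ kk : ℕ) : ℝ))⁻¹) • A' μ x'))) + (cvNVr' d L mv kk r hL a ι e (fun μ x' => NormedSpace.exp (((((L ^ r * L ^ kk : ℕ) : ℝ))⁻¹) • A' μ x')))))) ((covLapM (bshiftEquiv (cvM d L mv kk hL) (L ^ kk)) ((((L ^ kk : ℕ) : ℝ))⁻¹) (gaugePair (bshiftEquiv (cvM d L mv kk hL) (L ^ kk)) (fun μ x => coordMat e (ContinuousLinearMap.mulLeftRight ℝ (Matrix mm mm ℂ) (NormedSpace.exp (((((L ^ kk : ℕ) : ℝ))⁻¹) • gavgM (Matrix mm mm ℂ) (Fin (d + 1)) (kingPrV L kk r (cvM d L mv kk hL)) A' μ x))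 (NormedSpace.exp (((((L ^ kk : ℕ) : ℝ))⁻¹) • gavgM (Matrix mm mm ℂ) (Fin (d + 1)) (kingPrV L kk r (cvM d L mv kk hL)) A' μ x))ᴴ)))) ∘ₗ (cvGlued d L mv kk hL a ((((L ^ kk : ℕ) : ℝ))⁻¹) ι e (fun _ _ => (1 : Matrix mm mm ℂ)) (fun μ x => NormedSpace.exp (((((L ^ kk : ℕ) : ℝ))⁻¹) • gavgM (Matrix mm mm ℂ) (Fin (d + 1)) (kingPrV L kk r (cvM d L mv kk hL)) A' μ x)) (cvNL d L mv kk hL a ι - (cvNVq d L mv kk hL a ι e (fun μ x => NormedSpace.exp (((((L ^ kk : ℕ) : ℝ))⁻¹) • gavgM (Matrix mm mm ℂ) (Fin (d + 1)) (kingPrV L kk r (cvM d L mv kk hL)) A' μ x))) - (cvNVr d L mv kk hL a ι e (fun μ x => NormedSpace.exp (((((L ^ kk : ℕ) : ℝ))⁻¹) • gavgM (Matrix mm mm ℂ) (Fin (d + 1)) (kingPrV L kk r (cvM d L mv kk hL)) A' μ x)))) (fun _ => (cvNVq d L mv kk hL a ι e (fun μ x => NormedSpace.exp (((((L ^ kk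 : ℕ) : ℝ))⁻¹) • gavgM (Matrix mm mm ℂ) (Fin (d + 1)) (kingPrV L kk r (cvM d L mv kk hL)) A' μ x))) + (cvNVr d L mv kk hL a ι e (fun μ x => NormedSpace.exp (((((L ^ kk : ℕ) : ℝ))⁻¹) • gavgM (Matrix mm mm ℂ) (Fin (d + 1)) (kingPrV L kk r (cvM d L mv kk hL)) A' μ x)))))))
          (fun y y' => D₃ * ((((L ^ kk : ℕ) : ℝ)) ^ (-(1 / 16 : ℝ)) + ((14 * Real.exp 1 * (1 + Fintype.card (Fin (d + 1))) * basisConst e * ((1 + Fintype.card (Fin (d + 1))) * ((3 + 2 * ((d : ℝ) + 1)) * rA))) * (1 + Fintype.card (Fin (d + 1) ⊕ Fin (d + 1))) * ((((L ^ kk : ℕ) : ℝ))⁻¹) + 2 * (R₁ * (20 * ((((L ^ kk : ℕ) : ℝ))⁻¹) + 4 * Fintype.card ι * (@basisConst ι _ (Matrix mm mm ℂ) Matrix.frobeniusNormedAddCommGroup Matrix.frobeniusNormedSpace e * (2 * Real.sqrt (Fintype.card mm)) * (Real.sqrt (Fintype.card mm) * ((3 ^ (d + 1) * (72 * ((d :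 ℝ) + 1) ^ 2 + 9 * ((d : ℝ) + 1)) + (2 + 2 * Real.exp 1 + 2 * Real.exp 1 ^ 2 * ((d : ℝ) + 1))) * (rA * ((((L ^ kk : ℕ) : ℝ))⁻¹))))))) + (oR + oR))) * Real.exp (-(ρ * (unitTorusGeo L kk (cvM d L mv kk hL)).dist y y'))) := by
  have hLpos : 0 < L := Nat.pos_of_ne_zero (NeZero.ne L)
  have hLodd : Odd L := hL.1
  have hL2 : 2 ≤ L := by omega
  have hL1 : (1 : ℝ) ≤ L := by exact_mod_cast hLpos
  obtain ⟨δa, wa, Ra, θa, R1a, Da, hδa, hδac, hRa, hθa, hR1a, Ha⟩ := sfqr_idef_cvGlued (d := d) hL hL7 ha ι hδcap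
  obtain ⟨δb, wb, Rb, θb, R1b, Bb, hδb, hδbc, hRb, hθb, hR1b, hBb, Hb⟩ := sfqr_cvGlued_pair_spec (d := d) hL hL7 ha ι hδcap
  obtain ⟨δ₁, C₁, hδ₁, hC₁, HL⟩ := hasMaj_landauRe (d := d) (L := L)
  obtain ⟨δv, rr, hδv, hrr, HV⟩ := hasMaj_idef_nonlocal_family (d := d) hLodd hL2 ha (γ := 1 / 8) (by norm_num) (by norm_num)
  -- the master rate and the constants
  let m : ℝ := min (min (δa / 16) δb) (min δ₁ δv)
  have hm0 : 0 < m := lt_min (lt_min (by positivity) hδb) (lt_min hδ₁ hδv)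
  have hma : m ≤ δa / 16 := (min_le_left _ _).trans (min_le_left _ _)
  have hmb : m ≤ δb := (min_le_left _ _).trans (min_le_right _ _)
  have hm₁ : m ≤ δ₁ := (min_le_right _ _).trans (min_le_left _ _)
  have hmv : m ≤ δv := (min_le_right _ _).trans (min_le_right _ _)
  let cr : ℝ := B4Sect5Proof.latticeConst (d + 1) (m / 2)
  have hcr0 : 0 ≤ cr := B4Sect5Proof.latticeConst_nonneg (d + 1) (by positivity)
  let cN : ℝ := |a| * (Real.exp m * Real.exp m) + C₁
  have hcN0 : 0 ≤ cN := by positivity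
  have hcm0 : 0 ≤ B4Sect5Proof.latticeConst (d + 1) m := B4Sect5Proof.latticeConst_nonneg (d + 1) hm0.le
  let Rq : ℝ := 3 * |a| * (B4Sect5Proof.latticeConst (d + 1) m * Real.exp (3 * m)) + 1
  have hRq0 : 0 < Rq := by positivity
  let R₁ : ℝ := max (max R1a R1b) Rq
  have hR₁0 : 0 < R₁ := lt_max_of_lt_right hRq0
  have hR1aR : R1a ≤ R₁ := (le_max_left _ _).trans (le_max_left _ _)
  have hR1bR : R1b ≤ R₁ := (le_max_right _ _).trans (le_max_left _ _)
  have hRqR : Rq ≤ R₁ := le_max_right _ _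
  have hθm0 : 0 ≤ min θa θb := (lt_min hθa hθb).le
  refine ⟨m / 2, max wa wb, min Ra Rb, min θa θb, R₁, cr * ((cN + 2 * R₁ + min θa θb) * max Da 0 + (rr + 2) * Bb), by positivity, lt_min hRa hRb, lt_min hθa hθb, hR₁0,
    mul_nonneg hcr0 (add_nonneg (mul_nonneg (add_nonneg (by positivity) hθm0) (le_max_right _ _)) (by positivity)),
    fun mv kk r hk hw₀ => ?_⟩
  intro mm _ _ _ e he A' hA' rA hrA hrA1 h1 h2 h3 hr2 ρR oR hρR hoR hRle hθle hKc hKf hG1 hG2 hG3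
  have hwa : wa ≤ ((L ^ mv : ℕ) : ℝ) := (le_max_left _ _).trans hw₀
  have hwb : wb ≤ ((L ^ mv : ℕ) : ℝ) := (le_max_right _ _).trans hw₀
  -- the two spacings
  have hkpos : (0 : ℝ) < ((L ^ kk : ℕ) : ℝ) := Nat.cast_pos.mpr (pow_pos hLpos kk)
  have hrkpos : (0 : ℝ) < ((L ^ r * L ^ kk : ℕ) : ℝ) := Nat.cast_pos.mpr (Nat.mul_pos (pow_pos hLpos r) (pow_pos hLpos kk))
  have hη : (0 : ℝ) < ((((L ^ kk : ℕ) : ℝ))⁻¹) := inv_pos.mpr hkpos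
  have hη' : (0 : ℝ) < ((((L ^ r * L ^ kk : ℕ) : ℝ))⁻¹) := inv_pos.mpr hrkpos
  have hN : ((((L ^ kk : ℕ) : ℝ))⁻¹) = ((L ^ r : ℕ) : ℝ) * ((((L ^ r * L ^ kk : ℕ) : ℝ))⁻¹) := by
    have hr0 : ((L ^ r : ℕ) : ℝ) ≠ 0 := Nat.cast_ne_zero.mpr (pow_ne_zero _ (NeZero.ne L))
    rw [Nat.cast_mul]; field_simp
  have hη1 : ((((L ^ kk : ℕ) : ℝ))⁻¹) ≤ 1 := inv_le_one_of_one_le₀ (by exact_mod_cast Nat.one_le_pow kk L hLpos)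
  have hη'1 : ((((L ^ r * L ^ kk : ℕ) : ℝ))⁻¹) ≤ 1 := inv_le_one_of_one_le₀ (by exact_mod_cast Nat.mul_pos (Nat.one_le_pow r L hLpos) (Nat.one_le_pow kk L hLpos))
  have hn'η' : ((L ^ r * L ^ kk : ℕ) : ℝ) * ((((L ^ r * L ^ kk : ℕ) : ℝ))⁻¹) = 1 := mul_inv_cancel₀ hrkpos.ne'
  have hLrη' : ((L ^ r : ℕ) : ℝ) * ((((L ^ r * L ^ kk : ℕ) : ℝ))⁻¹) = ((((L ^ kk : ℕ) : ℝ))⁻¹) := hN.symm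
  have hC₀ : (0 : ℝ) ≤ 2 * ((d : ℝ) + 1) := by positivity
  have hCθ : (((2 * ((d + 1) * (L ^ r - 1)) : ℕ) : ℝ)) * ((((L ^ r * L ^ kk : ℕ) : ℝ))⁻¹) ≤ 2 * ((d : ℝ) + 1) * ((((L ^ kk : ℕ) : ℝ))⁻¹) := by
    have hsub : (((L ^ r - 1 : ℕ)) : ℝ) ≤ ((L ^ r : ℕ) : ℝ) := by exact_mod_cast Nat.sub_le _ _
    have hcast : (((2 * ((d + 1) * (L ^ r - 1)) : ℕ) : ℝ)) = 2 * ((d : ℝ) + 1) * (((L ^ r - 1 : ℕ)) : ℝ) := by push_cast; ring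
    rw [hcast, hN]
    have hr0 : (0 : ℝ) < ((L ^ r : ℕ) : ℝ) := Nat.cast_pos.mpr (pow_pos hLpos r)
    calc 2 * ((d : ℝ) + 1) * (((L ^ r - 1 : ℕ)) : ℝ) * ((((L ^ r * L ^ kk : ℕ) : ℝ))⁻¹) ≤ 2 * ((d : ℝ) + 1) * ((L ^ r : ℕ) : ℝ) * ((((L ^ r * L ^ kk : ℕ) : ℝ))⁻¹) :=
          mul_le_mul_of_nonneg_right (mul_le_mul_of_nonneg_left hsub hC₀) hη'.le
      _ = 2 * ((d : ℝ) + 1) * (((L ^ r : ℕ) : ℝ) * ((((L ^ r * L ^ kk : ℕ) : ℝ))⁻¹)) := by ring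
  -- the geometry of King's bond pairing on the cover
  have hcomm := fun μ κ (x : CvX' d L mv kk r hL) => bshiftEquiv_comm (cvM d L mv kk hL) (L ^ r * L ^ kk) μ κ x
  have hconn := fun (f : CvX' d L mv kk r hL → Matrix mm mm ℂ) (β : ℝ)
      (hf : ∀ κ x, ‖f (bshiftEquiv (cvM d L mv kk hL) (L ^ r * L ^ kk) κ x) - f x‖ ≤ β) => fibre_conn_kingPrV L kk r (cvM d L mv kk hL) f β hf
  have hblk := fun μ (x' : CvX' d L mv kk r hL) => kingPrV_bshiftEquiv_pow L kk r (cvM d L mv kk hL) μ x'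
  -- skewness, in the matrix algebra and in coordinates; unitarity of the transporters; the sup of the block mean
  have hAm : ∀ μ x, (gavgM (Matrix mm mm ℂ) (Fin (d + 1)) (kingPrV L kk r (cvM d L mv kk hL)) A' μ x)ᴴ = -gavgM (Matrix mm mm ℂ) (Fin (d + 1)) (kingPrV L kk r (cvM d L mv kk hL)) A' μ x := gavgM_conjTranspose_of_skew (kingPrV L kk r (cvM d L mv kk hL)) hA'
  have hA'c := fun μ x' => coordMat_adCLM_transpose_eq_neg_of_conjTranspose e he (hA' μ x')
  have hAmc := fun μ x => coordMat_adCLM_transpose_eq_neg_of_conjTranspose e he (hAm μ x)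
  have hUu : ∀ μ x, ((fun μ x => NormedSpace.exp (((((L ^ kk : ℕ) : ℝ))⁻¹) • gavgM (Matrix mm mm ℂ) (Fin (d + 1)) (kingPrV L kk r (cvM d L mv kk hL)) A' μ x)) μ x)ᴴ * (fun μ x => NormedSpace.exp (((((L ^ kk : ℕ) : ℝ))⁻¹) • gavgM (Matrix mm mm ℂ) (Fin (d + 1)) (kingPrV L kk r (cvM d L mv kk hL)) A' μ x)) μ x = 1 := fun μ x => exp_smul_unitary_of_conjTranspose (hAm μ x) _
  have hU'u : ∀ μ x', ((fun μ x' => NormedSpace.exp (((((L ^ r * L ^ kk : ℕ) : ℝ))⁻¹) • A' μ x')) μ x')ᴴ * (fun μ x' => NormedSpace.exp (((((L ^ r * L ^ kk : ℕ) : ℝ))⁻¹) • A' μ x')) μ x' = 1 := fun μ x' => exp_smul_unitary_of_conjTranspose (hA' μ x') _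
  obtain ⟨g1, -, -, -, -, -⟩ := gaugeLetters_of_mean (π := (kingPrV L kk r (cvM d L mv kk hL))) (s := bshiftEquiv (cvM d L mv kk hL) (L ^ kk))
    (s' := bshiftEquiv (cvM d L mv kk hL) (L ^ r * L ^ kk)) (N := L ^ r) (Cπ := (((2 * ((d + 1) * (L ^ r - 1)) : ℕ) : ℝ))) hcomm hconn hblk hη' hN hη hrA h1 h2 h3
  -- the scale conditions at each source's `R₁`
  have hκ0 : 0 ≤ basisConst e := basisConst_nonneg e
  have hκF := @basisConst_nonneg ι _ (Matrix mm mm ℂ) Matrix.frobeniusNormedAddCommGroup Matrix.frobeniusNormedSpace e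
  have hS0 : 0 ≤ (14 * Real.exp 1 * (1 + Fintype.card (Fin (d + 1))) * basisConst e * ((1 + Fintype.card (Fin (d + 1))) * ((3 + 2 * ((d : ℝ) + 1)) * rA))) := by positivity
  have hKC0 : 0 ≤ ((1 + Fintype.card ι * (@basisConst ι _ (Matrix mm mm ℂ) Matrix.frobeniusNormedAddCommGroup Matrix.frobeniusNormedSpace e * (2 * Real.sqrt (Fintype.card mm)) * (Real.sqrt (Fintype.card mm) * (2 * (rA * ((((L ^ kk : ℕ) : ℝ))⁻¹)))))) ^ ((d + 2) * L ^ kk) - 1) := by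
    have := one_le_pow₀ (M₀ := ℝ) (a := 1 + Fintype.card ι * (@basisConst ι _ (Matrix mm mm ℂ) Matrix.frobeniusNormedAddCommGroup Matrix.frobeniusNormedSpace e * (2 * Real.sqrt (Fintype.card mm)) * (Real.sqrt (Fintype.card mm) * (2 * (rA * ((((L ^ kk : ℕ) : ℝ))⁻¹)))))) (le_add_of_nonneg_right (by positivity)) (n := (d + 2) * L ^ kk); linarith
  have hKF0 : 0 ≤ ((1 + Fintype.card ι * (@basisConst ι _ (Matrix mm mm ℂ) Matrix.frobeniusNormedAddCommGroup Matrix.frobeniusNormedSpace e * (2 * Real.sqrt (Fintype.card mm)) * (Real.sqrt (Fintype.card mm) * (2 * (rA * ((((L ^ r * L ^ kk : ℕ) : ℝ))⁻¹)))))) ^ ((d + 2) * (L ^ r * L ^ kk)) - 1) := by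
    have := one_le_pow₀ (M₀ := ℝ) (a := 1 + Fintype.card ι * (@basisConst ι _ (Matrix mm mm ℂ) Matrix.frobeniusNormedAddCommGroup Matrix.frobeniusNormedSpace e * (2 * Real.sqrt (Fintype.card mm)) * (Real.sqrt (Fintype.card mm) * (2 * (rA * ((((L ^ r * L ^ kk : ℕ) : ℝ))⁻¹)))))) (le_add_of_nonneg_right (by positivity)) (n := (d + 2) * (L ^ r * L ^ kk)); linarith
  have hKK0 : 0 ≤ ((1 + Fintype.card ι * (@basisConst ι _ (Matrix mm mm ℂ) Matrix.frobeniusNormedAddCommGroup Matrix.frobeniusNormedSpace e * (2 * Real.sqrt (Fintype.card mm)) * (Real.sqrt (Fintype.card mm) * (2 * (rA * ((((L ^ kk : ℕ) : ℝ))⁻¹)))))) ^ ((d + 2) * L ^ kk) - 1) + ((1 + Fintype.card ι * (@basisConst ι _ (Matrix mm mm ℂ) Matrix.frobeniusNormedAddCommGroup Matrix.frobeniusNormedSpace e * (2 * Real.sqrt (Fintype.card mm)) * (Real.sqrt (Fintype.card mm) * (2 * (rA * ((((L ^ r * L ^ kk : ℕ) : ℝ))⁻¹)))))) ^ ((d +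 2) * (L ^ r * L ^ kk)) - 1) := add_nonneg hKC0 hKF0
  have hRaa : (14 * Real.exp 1 * (1 + Fintype.card (Fin (d + 1))) * basisConst e * ((1 + Fintype.card (Fin (d + 1))) * ((3 + 2 * ((d : ℝ) + 1)) * rA))) * (1 + Fintype.card (Fin (d + 1) ⊕ Fin (d + 1))) + (R1a * (((1 + Fintype.card ι * (@basisConst ι _ (Matrix mm mm ℂ) Matrix.frobeniusNormedAddCommGroup Matrix.frobeniusNormedSpace e * (2 * Real.sqrt (Fintype.card mm)) * (Real.sqrt (Fintype.card mm) * (2 * (rA * ((((L ^ kk : ℕ) : ℝ))⁻¹)))))) ^ ((d + 2) * L ^ kk) - 1) + ((1 + Fintype.card ι * (@basisConst ι _ (Matrix mm mm ℂ) Matrix.frobeniusNormedAddCommGroup Matrix.frobeniusNormedSpace e * (2 * Real.sqrt (Fintype.card mm)) * (Real.sqrt (Fintype.card mm) * (2 * (rA * ((((L ^ r * L ^ kk : ℕ) : ℝ))⁻¹)))))) ^ ((d + 2) * (L ^ r * L ^ kk)) - 1)) + ρR) ≤ Ra := by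
    have h := mul_le_mul_of_nonneg_right hR1aR hKK0; linarith [hRle.trans (min_le_left Ra Rb)]
  have hθaa : R1a * (((1 + Fintype.card ι * (@basisConst ι _ (Matrix mm mm ℂ) Matrix.frobeniusNormedAddCommGroup Matrix.frobeniusNormedSpace e * (2 * Real.sqrt (Fintype.card mm)) * (Real.sqrt (Fintype.card mm) * (2 * (rA * ((((L ^ kk : ℕ) : ℝ))⁻¹)))))) ^ ((d + 2) * L ^ kk) - 1) + ((1 + Fintype.card ι * (@basisConst ι _ (Matrix mm mm ℂ) Matrix.frobeniusNormedAddCommGroup Matrix.frobeniusNormedSpace e * (2 * Real.sqrt (Fintype.card mm)) * (Real.sqrt (Fintype.card mm) * (2 * (rA * ((((L ^ r * L ^ kk : ℕ) : ℝ))⁻¹)))))) ^ ((d + 2) * (L ^ r * L ^ kk)) - 1)) + ρR ≤ θa := by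
    have h := mul_le_mul_of_nonneg_right hR1aR hKK0; linarith [hθle.trans (min_le_left θa θb)]
  have hRbb : (14 * Real.exp 1 * (1 + Fintype.card (Fin (d + 1))) * basisConst e * ((1 + Fintype.card (Fin (d + 1))) * ((3 + 2 * ((d : ℝ) + 1)) * rA))) * (1 + Fintype.card (Fin (d + 1) ⊕ Fin (d + 1))) + R1b * (((1 + Fintype.card ι * (@basisConst ι _ (Matrix mm mm ℂ) Matrix.frobeniusNormedAddCommGroup Matrix.frobeniusNormedSpace e * (2 * Real.sqrt (Fintype.card mm)) * (Real.sqrt (Fintype.card mm) * (2 * (rA * ((((L ^ kk : ℕ) : ℝ))⁻¹)))))) ^ ((d + 2) * L ^ kk) - 1) + ((1 + Fintype.card ι * (@basisConst ι _ (Matrix mm mm ℂ) Matrix.frobeniusNormedAddCommGroup Matrix.frobeniusNormedSpace e * (2 * Real.sqrt (Fintype.card mm)) * (Real.sqrt (Fintype.card mm) * (2 * (rA * ((((L ^ r * L ^ kk : ℕ) : ℝ))⁻¹)))))) ^ ((d + 2) * (L ^ r * L ^ kk)) - 1)) + ρR ≤ Rb := by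
    have h := mul_le_mul_of_nonneg_right hR1bR hKK0; linarith [hRle.trans (min_le_right Ra Rb)]
  have hθbb : R1b * (((1 + Fintype.card ι * (@basisConst ι _ (Matrix mm mm ℂ) Matrix.frobeniusNormedAddCommGroup Matrix.frobeniusNormedSpace e * (2 * Real.sqrt (Fintype.card mm)) * (Real.sqrt (Fintype.card mm) * (2 * (rA * ((((L ^ kk : ℕ) : ℝ))⁻¹)))))) ^ ((d + 2) * L ^ kk) - 1) + ((1 + Fintype.card ι * (@basisConst ι _ (Matrix mm mm ℂ) Matrix.frobeniusNormedAddCommGroup Matrix.frobeniusNormedSpace e * (2 * Real.sqrt (Fintype.card mm)) * (Real.sqrt (Fintype.card mm) * (2 * (rA * ((((L ^ r * L ^ kk : ℕ) : ℝ))⁻¹)))))) ^ ((d + 2) * (L ^ r * L ^ kk)) - 1)) + ρR ≤ θb := by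
    have h := mul_le_mul_of_nonneg_right hR1bR hKK0; linarith [hθle.trans (min_le_right θa θb)]
  -- (P-R) the displayed Landau rows read at the sources' rates
  have hd00 := unitTorusGeo_dist_nonneg L kk (cvM d L mv kk hL)
  have hmcap : m ≤ δcap := hma.trans ((div_le_self hδa.le (by norm_num)).trans hδac)
  have hG1a := hG1.of_rate_le hd00 hρR hδac
  have hG2a := hG2.of_rate_le hd00 hρR hδac
  have hG3a := hG3.of_rate_le hd00 hoR hδac
  have hG2m := hG2.of_rate_le hd00 hρR hmcap
  have hG3m := hG3.of_rate_le hd00 hoR hmcap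
  obtain ⟨hRnc, hRnf, hRdn, hRfc, hRff, hRdf⟩ := cv_landauRows_of_global e mv kk r hL a hρR hρR hoR hG1a hG2a hG3a
  have key0 := Ha mv kk r hk hwa e he A' hA' rA hrA hrA1 h1 h2 h3 hr2 ρR ρR oR oR hρR hρR hoR hoR hRaa hθaa hRnc hRnf hRdn hRfc hRff hRdf hKc hKf
  obtain ⟨⟨hG, -, hGi⟩, ⟨-, -, hGi'⟩⟩ := Hb mv kk r hk hwb e he A' hA' rA hrA hrA1 h1 h2 h3 hr2 ρR hρR hRbb hθbb hKc hKf hG1 hG2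
  -- `Δ G = 1 − P G` on both grids
  rw [LinearMap.add_comp] at hGi hGi'
  rw [eq_sub_of_add_eq hGi, eq_sub_of_add_eq hGi', idef_sub, idef_id_id, zero_sub, idef_comp (pull (liftMap (kingPrV L kk r (cvM d L mv kk hL)) ι)) (pull (liftMap (kingPrV L kk r (cvM d L mv kk hL)) ι)) (pull (liftMap (kingPrV L kk r (cvM d L mv kk hL)) ι))]
  -- positivity of the scalars
  have hx0 : (0 : ℝ) ≤ (((L ^ kk : ℕ) : ℝ)) ^ (-(1 / 16 : ℝ)) := Real.rpow_nonneg hkpos.le _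
  have hΛΦ0 : 0 ≤ Fintype.card ι * (@basisConst ι _ (Matrix mm mm ℂ) Matrix.frobeniusNormedAddCommGroup Matrix.frobeniusNormedSpace e * (2 * Real.sqrt (Fintype.card mm)) * (Real.sqrt (Fintype.card mm) * ((3 ^ (d + 1) * (72 * ((d : ℝ) + 1) ^ 2 + 9 * ((d : ℝ) + 1)) + (2 + 2 * Real.exp 1 + 2 * Real.exp 1 ^ 2 * ((d : ℝ) + 1))) * (rA * ((((L ^ kk : ℕ) : ℝ))⁻¹))))) := by positivity
  have hON0 : 0 ≤ (R₁ * (20 * ((((L ^ kk : ℕ) : ℝ))⁻¹) + 4 * Fintype.card ι * (@basisConst ι _ (Matrix mm mm ℂ) Matrix.frobeniusNormedAddCommGroup Matrix.frobeniusNormedSpace e * (2 * Real.sqrt (Fintype.card mm)) * (Real.sqrt (Fintype.card mm) * ((3 ^ (d + 1) * (72 * ((d : ℝ) + 1) ^ 2 + 9 * ((d : ℝ) + 1)) + (2 + 2 * Real.exp 1 + 2 * Real.exp 1 ^ 2 * ((d : ℝ) + 1))) * (rA * ((((L ^ kk : ℕ) : ℝ))⁻¹))))))) := by positivity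
  have hX0 : 0 ≤ ((((L ^ kk : ℕ) : ℝ)) ^ (-(1 / 16 : ℝ)) + ((14 * Real.exp 1 * (1 + Fintype.card (Fin (d + 1))) * basisConst e * ((1 + Fintype.card (Fin (d + 1))) * ((3 + 2 * ((d : ℝ) + 1)) * rA))) * (1 + Fintype.card (Fin (d + 1) ⊕ Fin (d + 1))) * ((((L ^ kk : ℕ) : ℝ))⁻¹) + 2 * (R₁ * (20 * ((((L ^ kk : ℕ) : ℝ))⁻¹) + 4 * Fintype.card ι * (@basisConst ι _ (Matrix mm mm ℂ) Matrix.frobeniusNormedAddCommGroup Matrix.frobeniusNormedSpace e * (2 * Real.sqrt (Fintype.card mm)) * (Real.sqrt (Fintype.card mm) * ((3 ^ (d + 1) * (72 * ((d : ℝ) + 1) ^ 2 + 9 * ((d : ℝ) + 1)) + (2 + 2 * Real.exp 1 + 2 * Real.exp 1 ^ 2 * ((d : ℝ) + 1))) * (rA * ((((L ^ kk : ℕ) : ℝ))⁻¹))))))) + (oR + oR))) := add_nonneg (Real.rpow_nonneg hkpos.le _) (add_nonneg (by positivity) (add_nonneg hoR hoR))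
  have hXa : ((((L ^ kk : ℕ) : ℝ)) ^ (-(1 / 16 : ℝ)) + ((14 * Real.exp 1 * (1 + Fintype.card (Fin (d + 1))) * basisConst e * ((1 + Fintype.card (Fin (d + 1))) * ((3 + 2 * ((d : ℝ) + 1)) * rA))) * (1 + Fintype.card (Fin (d + 1) ⊕ Fin (d + 1))) * ((((L ^ kk : ℕ) : ℝ))⁻¹) + 2 * (R1a * (20 * ((((L ^ kk : ℕ) : ℝ))⁻¹) + 4 * Fintype.card ι * (@basisConst ι _ (Matrix mm mm ℂ) Matrix.frobeniusNormedAddCommGroup Matrix.frobeniusNormedSpace e * (2 * Real.sqrt (Fintype.card mm)) * (Real.sqrt (Fintype.card mm) * ((3 ^ (d + 1) * (72 * ((d : ℝ) + 1) ^ 2 + 9 * ((d : ℝ) + 1)) + (2 + 2 * Real.exp 1 + 2 * Real.exp 1 ^ 2 * ((d : ℝ) + 1))) * (rA * ((((L ^ kk : ℕ) : ℝ))⁻¹))))))) + (oR + oR))) ≤ ((((L ^ kk : ℕ) : ℝ)) ^ (-(1 / 16 : ℝ)) + ((14 * Real.exp 1 * (1 + Fintype.card (Fin (d + 1))) * basisConst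 e * ((1 + Fintype.card (Fin (d + 1))) * ((3 + 2 * ((d : ℝ) + 1)) * rA))) * (1 + Fintype.card (Fin (d + 1) ⊕ Fin (d + 1))) * ((((L ^ kk : ℕ) : ℝ))⁻¹) + 2 * (R₁ * (20 * ((((L ^ kk : ℕ) : ℝ))⁻¹) + 4 * Fintype.card ι * (@basisConst ι _ (Matrix mm mm ℂ) Matrix.frobeniusNormedAddCommGroup Matrix.frobeniusNormedSpace e * (2 * Real.sqrt (Fintype.card mm)) * (Real.sqrt (Fintype.card mm) * ((3 ^ (d + 1) * (72 * ((d : ℝ) + 1) ^ 2 + 9 * ((d : ℝ) + 1)) + (2 + 2 * Real.exp 1 + 2 * Real.exp 1 ^ 2 * ((d : ℝ) + 1))) * (rA * ((((L ^ kk : ℕ) : ℝ))⁻¹))))))) + (oR + oR))) := by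
    have h := mul_le_mul_of_nonneg_right hR1aR (show (0:ℝ) ≤ 20 * ((((L ^ kk : ℕ) : ℝ))⁻¹) + 4 * Fintype.card ι * (@basisConst ι _ (Matrix mm mm ℂ) Matrix.frobeniusNormedAddCommGroup Matrix.frobeniusNormedSpace e * (2 * Real.sqrt (Fintype.card mm)) * (Real.sqrt (Fintype.card mm) * ((3 ^ (d + 1) * (72 * ((d : ℝ) + 1) ^ 2 + 9 * ((d : ℝ) + 1)) + (2 + 2 * Real.exp 1 + 2 * Real.exp 1 ^ 2 * ((d : ℝ) + 1))) * (rA * ((((L ^ kk : ℕ) : ℝ))⁻¹))))) by positivity)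
    linarith
  have hXa0 : 0 ≤ ((((L ^ kk : ℕ) : ℝ)) ^ (-(1 / 16 : ℝ)) + ((14 * Real.exp 1 * (1 + Fintype.card (Fin (d + 1))) * basisConst e * ((1 + Fintype.card (Fin (d + 1))) * ((3 + 2 * ((d : ℝ) + 1)) * rA))) * (1 + Fintype.card (Fin (d + 1) ⊕ Fin (d + 1))) * ((((L ^ kk : ℕ) : ℝ))⁻¹) + 2 * (R1a * (20 * ((((L ^ kk : ℕ) : ℝ))⁻¹) + 4 * Fintype.card ι * (@basisConst ι _ (Matrix mm mm ℂ) Matrix.frobeniusNormedAddCommGroup Matrix.frobeniusNormedSpace e * (2 * Real.sqrt (Fintype.card mm)) * (Real.sqrt (Fintype.card mm) * ((3 ^ (d + 1) * (72 * ((d : ℝ) + 1) ^ 2 + 9 * ((d : ℝ) + 1)) + (2 + 2 * Real.exp 1 + 2 * Real.exp 1 ^ 2 * ((d : ℝ) + 1))) * (rA * ((((L ^ kk : ℕ) : ℝ))⁻¹))))))) + (oR + oR))) := add_nonneg (Real.rpow_nonneg hkpos.le _) (add_nonneg (by positivity) (add_nonneg hoR hoR))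
  -- (P-Q) the transporter letters of `e^{ηĀ′}`, `e^{η′A′}` (rows AND columns), weakened by `e^{x} − 1 ≤ 2x`
  have hexpc : Real.exp (((((L ^ kk : ℕ) : ℝ))⁻¹) * rA) - 1 ≤ 2 * (rA * ((((L ^ kk : ℕ) : ℝ))⁻¹)) := by
    have h := exp_sub_one_le_two_mul (x := ((((L ^ kk : ℕ) : ℝ))⁻¹) * rA) (by positivity) (mul_le_one₀ hη1 hrA hrA1); linarith [mul_comm ((((L ^ kk : ℕ) : ℝ))⁻¹) rA]
  have hexpf : Real.exp (((((L ^ r * L ^ kk : ℕ) : ℝ))⁻¹) * rA) - 1 ≤ 2 * (rA * ((((L ^ r * L ^ kk : ℕ) : ℝ))⁻¹)) := by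
    have h := exp_sub_one_le_two_mul (x := ((((L ^ r * L ^ kk : ℕ) : ℝ))⁻¹) * rA) (by positivity) (mul_le_one₀ hη'1 hrA hrA1); linarith [mul_comm ((((L ^ r * L ^ kk : ℕ) : ℝ))⁻¹) rA]
  have hTr : ∀ μ p i, ∑ j, |(cvT e (fun μ x => NormedSpace.exp (((((L ^ kk : ℕ) : ℝ))⁻¹) • gavgM (Matrix mm mm ℂ) (Fin (d + 1)) (kingPrV L kk r (cvM d L mv kk hL)) A' μ x)) μ p - 1) i j| ≤ Fintype.card ι * (@basisConst ι _ (Matrix mm mm ℂ) Matrix.frobeniusNormedAddCommGroup Matrix.frobeniusNormedSpace e * (2 * Real.sqrt (Fintype.card mm)) * (Real.sqrt (Fintype.card mm) * (2 * (rA * ((((L ^ kk : ℕ) : ℝ))⁻¹))))) := fun μ p i =>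
    (sf_rows_cvT_exp_sub_one_le e hη.le hAm g1 μ p i).trans (by gcongr)
  have hTc : ∀ μ p j, ∑ i, |(cvT e (fun μ x => NormedSpace.exp (((((L ^ kk : ℕ) : ℝ))⁻¹) • gavgM (Matrix mm mm ℂ) (Fin (d + 1)) (kingPrV L kk r (cvM d L mv kk hL)) A' μ x)) μ p - 1) i j| ≤ Fintype.card ι * (@basisConst ι _ (Matrix mm mm ℂ) Matrix.frobeniusNormedAddCommGroup Matrix.frobeniusNormedSpace e * (2 * Real.sqrt (Fintype.card mm)) * (Real.sqrt (Fintype.card mm) * (2 * (rA * ((((L ^ kk : ℕ) : ℝ))⁻¹))))) := fun μ p j =>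
    (sf_cols_cvT_exp_sub_one_le e hη.le hAm g1 μ p j).trans (by gcongr)
  have hTr' : ∀ μ p i, ∑ j, |(cvT e (fun μ x' => NormedSpace.exp (((((L ^ r * L ^ kk : ℕ) : ℝ))⁻¹) • A' μ x')) μ p - 1) i j| ≤ Fintype.card ι * (@basisConst ι _ (Matrix mm mm ℂ) Matrix.frobeniusNormedAddCommGroup Matrix.frobeniusNormedSpace e * (2 * Real.sqrt (Fintype.card mm)) * (Real.sqrt (Fintype.card mm) * (2 * (rA * ((((L ^ r * L ^ kk : ℕ) : ℝ))⁻¹))))) := fun μ p i =>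
    (sf_rows_cvT_exp_sub_one_le e hη'.le hA' h1 μ p i).trans (by gcongr)
  have hTc' : ∀ μ p j, ∑ i, |(cvT e (fun μ x' => NormedSpace.exp (((((L ^ r * L ^ kk : ℕ) : ℝ))⁻¹) • A' μ x')) μ p - 1) i j| ≤ Fintype.card ι * (@basisConst ι _ (Matrix mm mm ℂ) Matrix.frobeniusNormedAddCommGroup Matrix.frobeniusNormedSpace e * (2 * Real.sqrt (Fintype.card mm)) * (Real.sqrt (Fintype.card mm) * (2 * (rA * ((((L ^ r * L ^ kk : ℕ) : ℝ))⁻¹))))) := fun μ p j =>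
    (sf_cols_cvT_exp_sub_one_le e hη'.le hA' h1 μ p j).trans (by gcongr)
  have hρc0 : 0 ≤ Fintype.card ι * (@basisConst ι _ (Matrix mm mm ℂ) Matrix.frobeniusNormedAddCommGroup Matrix.frobeniusNormedSpace e * (2 * Real.sqrt (Fintype.card mm)) * (Real.sqrt (Fintype.card mm) * (2 * (rA * ((((L ^ kk : ℕ) : ℝ))⁻¹))))) := by positivity
  have hρf0 : 0 ≤ Fintype.card ι * (@basisConst ι _ (Matrix mm mm ℂ) Matrix.frobeniusNormedAddCommGroup Matrix.frobeniusNormedSpace e * (2 * Real.sqrt (Fintype.card mm)) * (Real.sqrt (Fintype.card mm) * (2 * (rA * ((((L ^ r * L ^ kk : ℕ) : ℝ))⁻¹))))) := by positivity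
  -- (P-Q) the holonomy fit along Bałaban's contours (n15-c∕185c), simplified to `c_Φ(d)·r_A·η`
  have hM2 : ∀ μ : Fin (d + 1), 2 ≤ L ^ kk * cvM d L mv kk hL μ := fun μ => by
    rw [show cvM d L mv kk hL μ = 2 * L * L ^ mv from MP_succ_eq L mv kk hL μ]
    have h1k : 1 ≤ L ^ kk := Nat.one_le_pow kk L hLpos
    have h1m : 1 ≤ L ^ mv := Nat.one_le_pow mv L hLpos
    calc 2 = 1 * (2 * 1 * 1) := by ring
      _ ≤ L ^ kk * (2 * L * L ^ mv) := Nat.mul_le_mul h1k (Nat.mul_le_mul (Nat.mul_le_mul le_rfl hLpos) h1m)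
  have hΦle : (3 ^ (d + 1) * (((d : ℝ) + 1) * (36 * ((L ^ r * L ^ kk : ℕ) : ℝ) * (((((L ^ r * L ^ kk : ℕ) : ℝ))⁻¹) * ((((2 * ((d + 1) * (L ^ r - 1)) : ℕ) : ℝ)) * (rA * ((((L ^ r * L ^ kk : ℕ) : ℝ))⁻¹)))) + 9 * (((L ^ r : ℕ) : ℝ) * (((((L ^ r * L ^ kk : ℕ) : ℝ))⁻¹) * rA)))) + (2 * (rA * ((((L ^ kk : ℕ) : ℝ))⁻¹)) + 2 * (rA * ((((L ^ kk : ℕ) : ℝ))⁻¹)) * Real.exp 1 + Real.exp 1 * ((((2 * ((d + 1) * (L ^ r - 1)) : ℕ) : ℝ)) * (rA * ((((L ^ r * L ^ kk : ℕ) : ℝ))⁻¹))) * Real.exp 1)) ≤ ((3 ^ (d + 1) * (72 * ((d : ℝ) + 1) ^ 2 + 9 * ((d : ℝ) + 1)) + (2 + 2 * Real.exp 1 + 2 * Real.exp 1 ^ 2 * ((d : ℝ) + 1))) * (rA * ((((L ^ kk : ℕ) : ℝ))⁻¹))) := by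
    have hA1 : 36 * ((L ^ r * L ^ kk : ℕ) : ℝ) * (((((L ^ r * L ^ kk : ℕ) : ℝ))⁻¹) * ((((2 * ((d + 1) * (L ^ r - 1)) : ℕ) : ℝ)) * (rA * ((((L ^ r * L ^ kk : ℕ) : ℝ))⁻¹)))) ≤ 36 * (2 * ((d : ℝ) + 1) * ((((L ^ kk : ℕ) : ℝ))⁻¹) * rA) := by
      rw [show 36 * ((L ^ r * L ^ kk : ℕ) : ℝ) * (((((L ^ r * L ^ kk : ℕ) : ℝ))⁻¹) * ((((2 * ((d + 1) * (L ^ r - 1)) : ℕ) : ℝ)) * (rA * ((((L ^ r * L ^ kk : ℕ) : ℝ))⁻¹)))) = 36 * (((L ^ r * L ^ kk : ℕ) : ℝ) * ((((L ^ r * L ^ kk : ℕ) : ℝ))⁻¹)) * ((((2 * ((d + 1) * (L ^ r - 1)) : ℕ) : ℝ)) * ((((L ^ r * L ^ kk : ℕ) : ℝ))⁻¹) * rA) by ring, hn'η', mul_one]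
      exact mul_le_mul_of_nonneg_left (mul_le_mul_of_nonneg_right hCθ hrA) (by norm_num)
    have hA2 : 9 * (((L ^ r : ℕ) : ℝ) * (((((L ^ r * L ^ kk : ℕ) : ℝ))⁻¹) * rA)) = 9 * (((((L ^ kk : ℕ) : ℝ))⁻¹) * rA) := by
      rw [show 9 * (((L ^ r : ℕ) : ℝ) * (((((L ^ r * L ^ kk : ℕ) : ℝ))⁻¹) * rA)) = 9 * ((((L ^ r : ℕ) : ℝ) * ((((L ^ r * L ^ kk : ℕ) : ℝ))⁻¹)) * rA) by ring, hLrη']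
    have hA3 : Real.exp 1 * ((((2 * ((d + 1) * (L ^ r - 1)) : ℕ) : ℝ)) * (rA * ((((L ^ r * L ^ kk : ℕ) : ℝ))⁻¹))) * Real.exp 1 ≤ Real.exp 1 ^ 2 * (2 * ((d : ℝ) + 1) * ((((L ^ kk : ℕ) : ℝ))⁻¹) * rA) := by
      rw [show Real.exp 1 * ((((2 * ((d + 1) * (L ^ r - 1)) : ℕ) : ℝ)) * (rA * ((((L ^ r * L ^ kk : ℕ) : ℝ))⁻¹))) * Real.exp 1 = Real.exp 1 ^ 2 * ((((2 * ((d + 1) * (L ^ r - 1)) : ℕ) : ℝ)) * ((((L ^ r * L ^ kk : ℕ) : ℝ))⁻¹) * rA) by ring]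
      exact mul_le_mul_of_nonneg_left (mul_le_mul_of_nonneg_right hCθ hrA) (by positivity)
    have hd0 : (0 : ℝ) ≤ (d : ℝ) + 1 := by positivity
    calc (3 ^ (d + 1) * (((d : ℝ) + 1) * (36 * ((L ^ r * L ^ kk : ℕ) : ℝ) * (((((L ^ r * L ^ kk : ℕ) : ℝ))⁻¹) * ((((2 * ((d + 1) * (L ^ r - 1)) : ℕ) : ℝ)) * (rA * ((((L ^ r * L ^ kk : ℕ) : ℝ))⁻¹)))) + 9 * (((L ^ r : ℕ) : ℝ) * (((((L ^ r * L ^ kk : ℕ) : ℝ))⁻¹) * rA)))) + (2 * (rA * ((((L ^ kk : ℕ) : ℝ))⁻¹)) + 2 * (rA * ((((L ^ kk : ℕ) : ℝ))⁻¹)) * Real.exp 1 + Real.exp 1 * ((((2 * ((d + 1) * (L ^ r - 1)) : ℕ) : ℝ)) * (rA * ((((L ^ r * L ^ kk : ℕ) : ℝ))⁻¹))) * Real.exp 1))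
        ≤ 3 ^ (d + 1) * (((d : ℝ) + 1) * (36 * (2 * ((d : ℝ) + 1) * ((((L ^ kk : ℕ) : ℝ))⁻¹) * rA) + 9 * (((((L ^ kk : ℕ) : ℝ))⁻¹) * rA))) +
          (2 * (rA * ((((L ^ kk : ℕ) : ℝ))⁻¹)) + 2 * (rA * ((((L ^ kk : ℕ) : ℝ))⁻¹)) * Real.exp 1 + Real.exp 1 ^ 2 * (2 * ((d : ℝ) + 1) * ((((L ^ kk : ℕ) : ℝ))⁻¹) * rA)) :=
          add_le_add (mul_le_mul_of_nonneg_left (mul_le_mul_of_nonneg_left (add_le_add hA1 hA2.le) hd0) (by positivity)) (add_le_add le_rfl hA3)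
      _ = ((3 ^ (d + 1) * (72 * ((d : ℝ) + 1) ^ 2 + 9 * ((d : ℝ) + 1)) + (2 + 2 * Real.exp 1 + 2 * Real.exp 1 ^ 2 * ((d : ℝ) + 1))) * (rA * ((((L ^ kk : ℕ) : ℝ))⁻¹))) := by ring
  have hΦ0 : 0 ≤ ((3 ^ (d + 1) * (72 * ((d : ℝ) + 1) ^ 2 + 9 * ((d : ℝ) + 1)) + (2 + 2 * Real.exp 1 + 2 * Real.exp 1 ^ 2 * ((d : ℝ) + 1))) * (rA * ((((L ^ kk : ℕ) : ℝ))⁻¹))) := by positivity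
  have hhol : ∀ (x' : Tor (fine (L ^ r * L ^ kk) (cvM d L mv kk hL))) (μ : Fin (d + 1)) (s j δ' : ℕ), s < L ^ kk → j < L ^ r → δ' ≤ 1 →
      kingPr L kk r (cvM d L mv kk hL) (x' + j • unitVec (fine (L ^ r * L ^ kk) (cvM d L mv kk hL)) μ) = kingPr L kk r (cvM d L mv kk hL) x' + δ' • unitVec (fine (L ^ kk) (cvM d L mv kk hL)) μ →
      ‖holPath (cvM d L mv kk hL) (L ^ r * L ^ kk) (fun μ x' => NormedSpace.exp (((((L ^ r * L ^ kk : ℕ) : ℝ))⁻¹) • A' μ x')) (x', μ) (L ^ r * s + j) - holPath (cvM d L mv kk hL) (L ^ kk) (fun μ x => NormedSpace.exp (((((L ^ kk : ℕ) : ℝ))⁻¹) • gavgM (Matrix mm mm ℂ) (Fin (d + 1)) (kingPrV L kk r (cvM d L mv kk hL)) A' μ x)) (kingPr L kk r (cvM d L mv kk hL) x', μ) (s + δ')‖ ≤ ((3 ^ (d + 1) * (72 * ((d : ℝ) + 1) ^ 2 + 9 * ((d : ℝ) + 1)) + (2 + 2 * Real.exp 1 + 2 * Real.exp 1 ^ 2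 * ((d : ℝ) + 1))) * (rA * ((((L ^ kk : ℕ) : ℝ))⁻¹))) :=
    fun x' μ s j δ' hs hj hδ' hπ => (norm_holPath_two_grid_le (cvM d L mv kk hL) kk r hrA hrA1 h1 h2 hA' x' μ hs hj hδ' (hM2 μ) hπ).trans hΦle
  -- (a) the fine summand `P′ = N_L′ ⊗ 1 − N_V^Q′` on the cover's fine blocks
  have hNL' := hasMaj_nonlocalPart (L := L) (kk := kk) (M := cvM d L mv kk hL) (n := L ^ r * L ^ kk) (a := a) hC₁.le hm0.le hm₁ (HL kk (L ^ r * L ^ kk) (cvM d L mv kk hL))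
  have hN'ι : HasMaj (BlockNorm.ofBlocks (unitTorusGeo L kk (cvM d L mv kk hL)) (liftBlk (cvBlk d L mv kk hL ∘ kingPrV L kk r (cvM d L mv kk hL)) ι)) (BlockNorm.ofBlocks (unitTorusGeo L kk (cvM d L mv kk hL)) (liftBlk (cvBlk d L mv kk hL ∘ kingPrV L kk r (cvM d L mv kk hL)) ι)) (cvNL' d L mv kk r hL a ι) (fun y y' => cN * Real.exp (-(m * (unitTorusGeo L kk (cvM d L mv kk hL)).dist y y'))) :=
    hasMaj_src_tgt_congr (liftBlk_blkCover_comp_kingPrV (M := cvM d L mv kk hL) (ι := ι) (L := L) (kk := kk) (r := r)).symm (hasMaj_tensorId ι (fun y y' => by positivity) hNL')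
  have hconstQ' : |a| * (((1 + Fintype.card ι * (@basisConst ι _ (Matrix mm mm ℂ) Matrix.frobeniusNormedAddCommGroup Matrix.frobeniusNormedSpace e * (2 * Real.sqrt (Fintype.card mm)) * (Real.sqrt (Fintype.card mm) * (2 * (rA * ((((L ^ r * L ^ kk : ℕ) : ℝ))⁻¹)))))) ^ ((d + 2) * (L ^ r * L ^ kk)) - 1) * (2 + ((1 + Fintype.card ι * (@basisConst ι _ (Matrix mm mm ℂ) Matrix.frobeniusNormedAddCommGroup Matrix.frobeniusNormedSpace e * (2 * Real.sqrt (Fintype.card mm)) * (Real.sqrt (Fintype.card mm) * (2 * (rA * ((((L ^ r * L ^ kk : ℕ) : ℝ))⁻¹)))))) ^ ((d + 2) * (L ^ r * L ^ kk)) - 1)) * (B4Sect5Proof.latticeConst (d + 1) m * Real.exp (3 * m))) ≤ 2 * R₁ := by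
    have h3 : ((1 + Fintype.card ι * (@basisConst ι _ (Matrix mm mm ℂ) Matrix.frobeniusNormedAddCommGroup Matrix.frobeniusNormedSpace e * (2 * Real.sqrt (Fintype.card mm)) * (Real.sqrt (Fintype.card mm) * (2 * (rA * ((((L ^ r * L ^ kk : ℕ) : ℝ))⁻¹)))))) ^ ((d + 2) * (L ^ r * L ^ kk)) - 1) * (2 + ((1 + Fintype.card ι * (@basisConst ι _ (Matrix mm mm ℂ) Matrix.frobeniusNormedAddCommGroup Matrix.frobeniusNormedSpace e * (2 * Real.sqrt (Fintype.card mm)) * (Real.sqrt (Fintype.card mm) * (2 * (rA * ((((L ^ r * L ^ kk : ℕ) : ℝ))⁻¹)))))) ^ ((d + 2) * (L ^ r * L ^ kk)) - 1)) ≤ 3 := by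
      calc ((1 + Fintype.card ι * (@basisConst ι _ (Matrix mm mm ℂ) Matrix.frobeniusNormedAddCommGroup Matrix.frobeniusNormedSpace e * (2 * Real.sqrt (Fintype.card mm)) * (Real.sqrt (Fintype.card mm) * (2 * (rA * ((((L ^ r * L ^ kk : ℕ) : ℝ))⁻¹)))))) ^ ((d + 2) * (L ^ r * L ^ kk)) - 1) * (2 + ((1 + Fintype.card ι * (@basisConst ι _ (Matrix mm mm ℂ) Matrix.frobeniusNormedAddCommGroup Matrix.frobeniusNormedSpace e * (2 * Real.sqrt (Fintype.card mm)) * (Real.sqrt (Fintype.card mm) * (2 * (rA * ((((L ^ r * L ^ kk : ℕ) : ℝ))⁻¹)))))) ^ ((d + 2) * (L ^ r * L ^ kk)) - 1)) ≤ ((1 + Fintype.card ι * (@basisConst ι _ (Matrix mm mm ℂ) Matrix.frobeniusNormedAddCommGroup Matrix.frobeniusNormedSpace e * (2 * Real.sqrt (Fintype.card mm)) * (Real.sqrt (Fintype.card mm) * (2 * (rA * ((((L ^ r * L ^ kk : ℕ) : ℝ))⁻¹)))))) ^ ((d + 2) * (L ^ r * L ^ kk)) - 1) * 3 := mul_le_mul_of_nonneg_left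 (by linarith) hKF0
        _ ≤ 3 := by linarith
    have hce : 0 ≤ (B4Sect5Proof.latticeConst (d + 1) m * Real.exp (3 * m)) := mul_nonneg hcm0 (Real.exp_nonneg _)
    calc |a| * (((1 + Fintype.card ι * (@basisConst ι _ (Matrix mm mm ℂ) Matrix.frobeniusNormedAddCommGroup Matrix.frobeniusNormedSpace e * (2 * Real.sqrt (Fintype.card mm)) * (Real.sqrt (Fintype.card mm) * (2 * (rA * ((((L ^ r * L ^ kk : ℕ) : ℝ))⁻¹)))))) ^ ((d + 2) * (L ^ r * L ^ kk)) - 1) * (2 + ((1 + Fintype.card ι * (@basisConst ι _ (Matrix mm mm ℂ) Matrix.frobeniusNormedAddCommGroup Matrix.frobeniusNormedSpace e * (2 * Real.sqrt (Fintype.card mm)) * (Real.sqrt (Fintype.card mm) * (2 * (rA * ((((L ^ r * L ^ kk : ℕ) : ℝ))⁻¹)))))) ^ ((d + 2) * (L ^ r * L ^ kk)) - 1)) * (B4Sect5Proof.latticeConst (d + 1) m * Real.exp (3 * m))) ≤ |a| * (3 * (B4Sect5Proof.latticeConst (d + 1) m * Real.exp (3 * m))) := by gcongr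
      _ = 3 * |a| * (B4Sect5Proof.latticeConst (d + 1) m * Real.exp (3 * m)) := by ring
      _ ≤ Rq := by show 3 * |a| * (B4Sect5Proof.latticeConst (d + 1) m * Real.exp (3 * m)) ≤ 3 * |a| * (B4Sect5Proof.latticeConst (d + 1) m * Real.exp (3 * m)) + 1; linarith
      _ ≤ 2 * R₁ := by linarith
  have hQ'ι : HasMaj (BlockNorm.ofBlocks (unitTorusGeo L kk (cvM d L mv kk hL)) (liftBlk (cvBlk d L mv kk hL ∘ kingPrV L kk r (cvM d L mv kk hL)) ι)) (BlockNorm.ofBlocks (unitTorusGeo L kk (cvM d L mv kk hL)) (liftBlk (cvBlk d L mv kk hL ∘ kingPrV L kk r (cvM d L mv kk hL)) ι)) (cvNVq' d L mv kk r hL a ι e (fun μ x' => NormedSpace.exp (((((L ^ r * L ^ kk : ℕ) : ℝ))⁻¹) • A' μ x'))) (fun y y' => 2 * R₁ * Real.exp (-(m * (unitTorusGeo L kk (cvM d L mv kk hL)).dist y y'))) := by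
    have h := hasMaj_nvQ (L := L) (cvM d L mv kk hL) kk (L ^ r * L ^ kk) (T := cvT e (fun μ x' => NormedSpace.exp (((((L ^ r * L ^ kk : ℕ) : ℝ))⁻¹) • A' μ x'))) hρf0 hm0 hTr' hTc' a
    rw [liftBlk_blockOf_fine_eq (ι := ι) mv kk r hL] at h
    exact h.mono fun y y' => by rw [unitTorusGeo_dist]; exact mul_le_mul_of_nonneg_right hconstQ' (Real.exp_nonneg _)
  have hP'ι : HasMaj (BlockNorm.ofBlocks (unitTorusGeo L kk (cvM d L mv kk hL)) (liftBlk (cvBlk d L mv kk hL ∘ kingPrV L kk r (cvM d L mv kk hL)) ι)) (BlockNorm.ofBlocks (unitTorusGeo L kk (cvM d L mv kk hL)) (liftBlk (cvBlk d L mv kk hL ∘ kingPrV L kk r (cvM d L mv kk hL)) ι)) (cvNL' d L mv kk r hL a ι - (cvNVq' d L mv kk r hL a ι e (fun μ x' => NormedSpace.exp (((((L ^ r * L ^ kk : ℕ) : ℝ))⁻¹) • A' μ x'))) - (cvNVr' d L mv kk r hL a ι e (fun μ x' => NormedSpace.exp (((((L ^ r * L ^ kk : ℕ) : ℝ))⁻¹)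 • A' μ x')))) (fun y y' => (cN + 2 * R₁ + ρR) * Real.exp (-(m * (unitTorusGeo L kk (cvM d L mv kk hL)).dist y y'))) :=
    ((hN'ι.sub hQ'ι).sub hG2m).mono fun y y' => le_of_eq (by ring)
  -- (b) `𝔇(G′, G)` (n15-c∕188) with a non-negative constant and the exported `R₁`
  have hDa0 : 0 ≤ max Da 0 * ((((L ^ kk : ℕ) : ℝ)) ^ (-(1 / 16 : ℝ)) + ((14 * Real.exp 1 * (1 + Fintype.card (Fin (d + 1))) * basisConst e * ((1 + Fintype.card (Fin (d + 1))) * ((3 + 2 * ((d : ℝ) + 1)) * rA))) * (1 + Fintype.card (Fin (d + 1) ⊕ Fin (d + 1))) * ((((L ^ kk : ℕ) : ℝ))⁻¹) + 2 * (R₁ * (20 * ((((L ^ kk : ℕ) : ℝ))⁻¹) + 4 * Fintype.card ι * (@basisConst ι _ (Matrix mm mm ℂ) Matrix.frobeniusNormedAddCommGroup Matrix.frobeniusNormedSpace e * (2 * Real.sqrt (Fintype.card mm)) * (Real.sqrt (Fintype.card mm) * ((3 ^ (d + 1) * (72 * ((d : ℝ) + 1) ^ 2 + 9 * ((d : ℝ)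 + 1)) + (2 + 2 * Real.exp 1 + 2 * Real.exp 1 ^ 2 * ((d : ℝ) + 1))) * (rA * ((((L ^ kk : ℕ) : ℝ))⁻¹))))))) + (oR + oR))) := mul_nonneg (le_max_right _ _) hX0
  have key0' := key0.mono fun y y' => mul_le_mul_of_nonneg_right (mul_le_mul (le_max_left Da 0) hXa hXa0 (le_max_right _ _)) (Real.exp_nonneg _)
  -- (c) `𝔇(P′, P) = 𝔇(N_L′, N_L) − 𝔇(N_V^Q′, N_V^Q)` on the coloured carrier
  have hVι : HasMaj (CvNorm d L mv kk hL ι) (BlockNorm.ofBlocks (unitTorusGeo L kk (cvM d L mv kk hL)) (liftBlk (cvBlk d L mv kk hL ∘ kingPrV L kk r (cvM d L mv kk hL)) ι)) (idef (pull (liftMap (kingPrV L kk r (cvM d L mv kk hL)) ι)) (pull (liftMap (kingPrV L kk r (cvM d L mv kk hL)) ι)) (cvNL' d L mv kk r hL a ι) (cvNL d L mv kk hL a ι))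
      (fun y y' => rr * ((L ^ kk : ℕ) : ℝ) ^ (-((1 / 8 : ℝ) / 2)) * Real.exp (-(δv * tdistT (cvM d L mv kk hL) y y'))) :=
    hasMaj_tgt_congr (liftBlk_blkCover_comp_kingPrV (M := cvM d L mv kk hL) (ι := ι) (L := L) (kk := kk) (r := r)).symm
      (hasMaj_idef_tensorId (ι := ι) (kingPrV L kk r (cvM d L mv kk hL)) (fun y y' => by positivity) (HV (mv + 1) kk r hk hL))
  have hrr0 : 0 ≤ rr * ((L ^ kk : ℕ) : ℝ) ^ (-((1 / 8 : ℝ) / 2)) := mul_nonneg hrr.le (Real.rpow_nonneg hkpos.le _)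
  have hconstD : |a| * (B4Sect5Proof.latticeConst (d + 1) m * Real.exp (3 * m)) * (4 / (L ^ kk : ℕ) + (Fintype.card ι * (@basisConst ι _ (Matrix mm mm ℂ) Matrix.frobeniusNormedAddCommGroup Matrix.frobeniusNormedSpace e * (2 * Real.sqrt (Fintype.card mm)) * (Real.sqrt (Fintype.card mm) * ((3 ^ (d + 1) * (72 * ((d : ℝ) + 1) ^ 2 + 9 * ((d : ℝ) + 1)) + (2 + 2 * Real.exp 1 + 2 * Real.exp 1 ^ 2 * ((d : ℝ) + 1))) * (rA * ((((L ^ kk : ℕ) : ℝ))⁻¹))))) + 2 * ((1 + Fintype.card ι * (@basisConst ι _ (Matrix mm mm ℂ) Matrix.frobeniusNormedAddCommGroup Matrix.frobeniusNormedSpace e * (2 * Real.sqrt (Fintype.card mm)) * (Real.sqrt (Fintype.card mm) * (2 * (rA * ((((L ^ kk : ℕ) : ℝ))⁻¹)))))) ^ ((d + 2) * L ^ kk)) / (L ^ kk : ℕ)) * (2 + ((1 + Fintype.card ι * (@basisConst ι _ (Matrix mm mm ℂ) Matrix.frobeniusNormedAddCommGroup Matrix.frobeniusNormedSpace e * (2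 * Real.sqrt (Fintype.card mm)) * (Real.sqrt (Fintype.card mm) * (2 * (rA * ((((L ^ kk : ℕ) : ℝ))⁻¹)))))) ^ ((d + 2) * L ^ kk) - 1) + ((1 + Fintype.card ι * (@basisConst ι _ (Matrix mm mm ℂ) Matrix.frobeniusNormedAddCommGroup Matrix.frobeniusNormedSpace e * (2 * Real.sqrt (Fintype.card mm)) * (Real.sqrt (Fintype.card mm) * (2 * (rA * ((((L ^ r * L ^ kk : ℕ) : ℝ))⁻¹)))))) ^ ((d + 2) * (L ^ r * L ^ kk)) - 1))) ≤ (R₁ * (20 * ((((L ^ kk : ℕ) : ℝ))⁻¹) + 4 * Fintype.card ι * (@basisConst ι _ (Matrix mm mm ℂ) Matrix.frobeniusNormedAddCommGroup Matrix.frobeniusNormedSpace e * (2 * Real.sqrt (Fintype.card mm)) * (Real.sqrt (Fintype.card mm) * ((3 ^ (d + 1) * (72 * ((d : ℝ) + 1) ^ 2 + 9 * ((d : ℝ) + 1)) + (2 + 2 * Real.exp 1 + 2 * Real.exp 1 ^ 2 * ((d : ℝ) + 1))) * (rA * ((((L ^ kk : ℕ) : ℝ))⁻¹))))))) := by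
    have hpow : (1 + Fintype.card ι * (@basisConst ι _ (Matrix mm mm ℂ) Matrix.frobeniusNormedAddCommGroup Matrix.frobeniusNormedSpace e * (2 * Real.sqrt (Fintype.card mm)) * (Real.sqrt (Fintype.card mm) * (2 * (rA * ((((L ^ kk : ℕ) : ℝ))⁻¹)))))) ^ ((d + 2) * L ^ kk) ≤ 2 := by linarith
    have hΘ : 4 / (L ^ kk : ℕ) + (Fintype.card ι * (@basisConst ι _ (Matrix mm mm ℂ) Matrix.frobeniusNormedAddCommGroup Matrix.frobeniusNormedSpace e * (2 * Real.sqrt (Fintype.card mm)) * (Real.sqrt (Fintype.card mm) * ((3 ^ (d + 1) * (72 * ((d : ℝ) + 1) ^ 2 + 9 * ((d : ℝ) + 1)) + (2 + 2 * Real.exp 1 + 2 * Real.exp 1 ^ 2 * ((d : ℝ) + 1))) * (rA * ((((L ^ kk : ℕ) : ℝ))⁻¹))))) + 2 * ((1 + Fintype.card ι * (@basisConst ι _ (Matrix mm mm ℂ) Matrix.frobeniusNormedAddCommGroup Matrix.frobeniusNormedSpace e * (2 * Real.sqrt (Fintype.card mm)) * (Real.sqrt (Fintype.card mm) * (2 *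 (rA * ((((L ^ kk : ℕ) : ℝ))⁻¹)))))) ^ ((d + 2) * L ^ kk)) / (L ^ kk : ℕ)) * (2 + ((1 + Fintype.card ι * (@basisConst ι _ (Matrix mm mm ℂ) Matrix.frobeniusNormedAddCommGroup Matrix.frobeniusNormedSpace e * (2 * Real.sqrt (Fintype.card mm)) * (Real.sqrt (Fintype.card mm) * (2 * (rA * ((((L ^ kk : ℕ) : ℝ))⁻¹)))))) ^ ((d + 2) * L ^ kk) - 1) + ((1 + Fintype.card ι * (@basisConst ι _ (Matrix mm mm ℂ) Matrix.frobeniusNormedAddCommGroup Matrix.frobeniusNormedSpace e * (2 * Real.sqrt (Fintype.card mm)) * (Real.sqrt (Fintype.card mm) * (2 * (rA * ((((L ^ r * L ^ kk : ℕ) : ℝ))⁻¹)))))) ^ ((d + 2) * (L ^ r * L ^ kk)) - 1)) ≤ 20 * ((((L ^ kk : ℕ) : ℝ))⁻¹) + 4 * Fintype.card ι * (@basisConst ι _ (Matrix mm mm ℂ) Matrix.frobeniusNormedAddCommGroup Matrix.frobeniusNormedSpace e * (2 * Real.sqrt (Fintype.card mm)) * (Real.sqrt (Fintype.card mm) * ((3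 ^ (d + 1) * (72 * ((d : ℝ) + 1) ^ 2 + 9 * ((d : ℝ) + 1)) + (2 + 2 * Real.exp 1 + 2 * Real.exp 1 ^ 2 * ((d : ℝ) + 1))) * (rA * ((((L ^ kk : ℕ) : ℝ))⁻¹))))) := by
      rw [div_eq_mul_inv, div_eq_mul_inv]
      have hm' : (Fintype.card ι * (@basisConst ι _ (Matrix mm mm ℂ) Matrix.frobeniusNormedAddCommGroup Matrix.frobeniusNormedSpace e * (2 * Real.sqrt (Fintype.card mm)) * (Real.sqrt (Fintype.card mm) * ((3 ^ (d + 1) * (72 * ((d : ℝ) + 1) ^ 2 + 9 * ((d : ℝ) + 1)) + (2 + 2 * Real.exp 1 + 2 * Real.exp 1 ^ 2 * ((d : ℝ) + 1))) * (rA * ((((L ^ kk : ℕ) : ℝ))⁻¹))))) + 2 * ((1 + Fintype.card ι * (@basisConst ι _ (Matrix mm mm ℂ) Matrix.frobeniusNormedAddCommGroup Matrix.frobeniusNormedSpace e * (2 * Real.sqrt (Fintype.card mm)) * (Real.sqrt (Fintype.card mm) * (2 * (rA * ((((L ^ kk : ℕ) : ℝ))⁻¹)))))) ^ ((d + 2)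 * L ^ kk)) * ((((L ^ kk : ℕ) : ℝ))⁻¹)) * (2 + ((1 + Fintype.card ι * (@basisConst ι _ (Matrix mm mm ℂ) Matrix.frobeniusNormedAddCommGroup Matrix.frobeniusNormedSpace e * (2 * Real.sqrt (Fintype.card mm)) * (Real.sqrt (Fintype.card mm) * (2 * (rA * ((((L ^ kk : ℕ) : ℝ))⁻¹)))))) ^ ((d + 2) * L ^ kk) - 1) + ((1 + Fintype.card ι * (@basisConst ι _ (Matrix mm mm ℂ) Matrix.frobeniusNormedAddCommGroup Matrix.frobeniusNormedSpace e * (2 * Real.sqrt (Fintype.card mm)) * (Real.sqrt (Fintype.card mm) * (2 * (rA * ((((L ^ r * L ^ kk : ℕ) : ℝ))⁻¹)))))) ^ ((d + 2) * (L ^ r * L ^ kk)) - 1)) ≤ (Fintype.card ι * (@basisConst ι _ (Matrix mm mm ℂ) Matrix.frobeniusNormedAddCommGroup Matrix.frobeniusNormedSpace e * (2 * Real.sqrt (Fintype.card mm)) * (Real.sqrt (Fintype.card mm) * ((3 ^ (d + 1) * (72 * ((d : ℝ) + 1) ^ 2 + 9 * ((d : ℝ) + 1)) + (2 + 2 * Real.exp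 1 + 2 * Real.exp 1 ^ 2 * ((d : ℝ) + 1))) * (rA * ((((L ^ kk : ℕ) : ℝ))⁻¹))))) + 4 * ((((L ^ kk : ℕ) : ℝ))⁻¹)) * 4 :=
        mul_le_mul (add_le_add le_rfl (by have h4 := mul_le_mul_of_nonneg_right hpow hη.le; linarith)) (by linarith) (by positivity) (by positivity)
      linarith
    have hΘ0 : 0 ≤ 4 / (L ^ kk : ℕ) + (Fintype.card ι * (@basisConst ι _ (Matrix mm mm ℂ) Matrix.frobeniusNormedAddCommGroup Matrix.frobeniusNormedSpace e * (2 * Real.sqrt (Fintype.card mm)) * (Real.sqrt (Fintype.card mm) * ((3 ^ (d + 1) * (72 * ((d : ℝ) + 1) ^ 2 + 9 * ((d : ℝ) + 1)) + (2 + 2 * Real.exp 1 + 2 * Real.exp 1 ^ 2 * ((d : ℝ) + 1))) * (rA * ((((L ^ kk : ℕ) : ℝ))⁻¹))))) + 2 * ((1 + Fintype.card ι * (@basisConst ι _ (Matrix mm mm ℂ) Matrix.frobeniusNormedAddCommGroup Matrix.frobeniusNormedSpace e * (2 * Real.sqrt (Fintype.card mm)) * (Real.sqrt (Fintype.card mm)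 * (2 * (rA * ((((L ^ kk : ℕ) : ℝ))⁻¹)))))) ^ ((d + 2) * L ^ kk)) / (L ^ kk : ℕ)) * (2 + ((1 + Fintype.card ι * (@basisConst ι _ (Matrix mm mm ℂ) Matrix.frobeniusNormedAddCommGroup Matrix.frobeniusNormedSpace e * (2 * Real.sqrt (Fintype.card mm)) * (Real.sqrt (Fintype.card mm) * (2 * (rA * ((((L ^ kk : ℕ) : ℝ))⁻¹)))))) ^ ((d + 2) * L ^ kk) - 1) + ((1 + Fintype.card ι * (@basisConst ι _ (Matrix mm mm ℂ) Matrix.frobeniusNormedAddCommGroup Matrix.frobeniusNormedSpace e * (2 * Real.sqrt (Fintype.card mm)) * (Real.sqrt (Fintype.card mm) * (2 * (rA * ((((L ^ r * L ^ kk : ℕ) : ℝ))⁻¹)))))) ^ ((d + 2) * (L ^ r * L ^ kk)) - 1)) := by positivity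
    have hce : 0 ≤ (B4Sect5Proof.latticeConst (d + 1) m * Real.exp (3 * m)) := mul_nonneg hcm0 (Real.exp_nonneg _)
    have hR₁ge : |a| * (B4Sect5Proof.latticeConst (d + 1) m * Real.exp (3 * m)) ≤ R₁ := by
      have : |a| * (B4Sect5Proof.latticeConst (d + 1) m * Real.exp (3 * m)) ≤ Rq := by show |a| * (B4Sect5Proof.latticeConst (d + 1) m * Real.exp (3 * m)) ≤ 3 * |a| * (B4Sect5Proof.latticeConst (d + 1) m * Real.exp (3 * m)) + 1; linarith [mul_nonneg (abs_nonneg a) hce]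
      exact this.trans hRqR
    exact mul_le_mul hR₁ge hΘ hΘ0 hR₁0.le
  have hone : mulOp (fun p : CvX d L mv kk hL × ι => (fun _ : CvX d L mv kk hL => (1 : ℝ)) p.1) = LinearMap.id :=
    LinearMap.ext fun f => funext fun p => by simp [mulOp_apply]
  have hone' : mulOp ((fun p : CvX d L mv kk hL × ι => (fun _ : CvX d L mv kk hL => (1 : ℝ)) p.1) ∘ liftMap (kingPrV L kk r (cvM d L mv kk hL)) ι) =
      (LinearMap.id : (CvX' d L mv kk r hL × ι → ℝ) →ₗ[ℝ] (CvX' d L mv kk r hL × ι → ℝ)) :=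
    LinearMap.ext fun f => funext fun p => by simp [mulOp_apply]
  have hDq0 := cv_hasMaj_idef_sandwich_cvNVq e mv kk r hL a hρc0 hρf0 hΦ0 hm0 hTr hTc hTc' hUu hU'u hhol (fun _ => (1 : ℝ)) (fun _ => (1 : ℝ))
    (fun _ => by simp) (fun _ => by simp)
  rw [hone, hone', LinearMap.id_comp, LinearMap.comp_id, LinearMap.id_comp, LinearMap.comp_id] at hDq0
  have hDι : HasMaj (CvNorm d L mv kk hL ι) (BlockNorm.ofBlocks (unitTorusGeo L kk (cvM d L mv kk hL)) (liftBlk (cvBlk d L mv kk hL ∘ kingPrV L kk r (cvM d L mv kk hL)) ι)) (idef (pull (liftMap (kingPrV L kk r (cvM d L mv kk hL)) ι)) (pull (liftMap (kingPrV L kk r (cvM d L mv kk hL)) ι)) (cvNL' d L mv kk r hL a ι - (cvNVq' d L mv kk r hL a ι e (fun μ x' => NormedSpace.exp (((((L ^ r * L ^ kk : ℕ) : ℝ))⁻¹) • A' μ x'))) - (cvNVr' d L mv kk r hL a ι e (fun μ x' => NormedSpace.exp (((((L ^ r * L ^ kk : ℕ) : ℝ))⁻¹) • A' μ x')))) (cvNL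 d L mv kk hL a ι - (cvNVq d L mv kk hL a ι e (fun μ x => NormedSpace.exp (((((L ^ kk : ℕ) : ℝ))⁻¹) • gavgM (Matrix mm mm ℂ) (Fin (d + 1)) (kingPrV L kk r (cvM d L mv kk hL)) A' μ x))) - (cvNVr d L mv kk hL a ι e (fun μ x => NormedSpace.exp (((((L ^ kk : ℕ) : ℝ))⁻¹) • gavgM (Matrix mm mm ℂ) (Fin (d + 1)) (kingPrV L kk r (cvM d L mv kk hL)) A' μ x)))))
      (fun y y' => (rr * ((L ^ kk : ℕ) : ℝ) ^ (-((1 / 8 : ℝ) / 2)) + (R₁ * (20 * ((((L ^ kk : ℕ) : ℝ))⁻¹) + 4 * Fintype.card ι * (@basisConst ι _ (Matrix mm mm ℂ) Matrix.frobeniusNormedAddCommGroup Matrix.frobeniusNormedSpace e * (2 * Real.sqrt (Fintype.card mm)) * (Real.sqrt (Fintype.card mm) * ((3 ^ (d + 1) * (72 * ((d : ℝ) + 1) ^ 2 + 9 * ((d : ℝ) + 1)) + (2 + 2 * Real.exp 1 + 2 * Real.exp 1 ^ 2 * ((d : ℝ) + 1))) * (rA * ((((L ^ kk : ℕ) : ℝ))⁻¹)))))))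 + oR) * Real.exp (-(m * (unitTorusGeo L kk (cvM d L mv kk hL)).dist y y'))) := by
    rw [idef_sub, idef_sub]
    refine ((hVι.sub hDq0).sub hG3m).mono fun y y' => ?_
    have hd0 := unitTorusGeo_dist_nonneg L kk (cvM d L mv kk hL) y y'
    have he1 : Real.exp (-(δv * tdistT (cvM d L mv kk hL) y y')) ≤ Real.exp (-(m * (unitTorusGeo L kk (cvM d L mv kk hL)).dist y y')) := by
      rw [← unitTorusGeo_dist (L := L) (k := kk)]
      exact Real.exp_le_exp.mpr (neg_le_neg (mul_le_mul_of_nonneg_right hmv hd0))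
    have he0 : 0 ≤ Real.exp (-(m * (unitTorusGeo L kk (cvM d L mv kk hL)).dist y y')) := Real.exp_nonneg _
    calc rr * ((L ^ kk : ℕ) : ℝ) ^ (-((1 / 8 : ℝ) / 2)) * Real.exp (-(δv * tdistT (cvM d L mv kk hL) y y')) +
          |a| * (B4Sect5Proof.latticeConst (d + 1) m * Real.exp (3 * m)) * (4 / (L ^ kk : ℕ) + (Fintype.card ι * (@basisConst ι _ (Matrix mm mm ℂ) Matrix.frobeniusNormedAddCommGroup Matrix.frobeniusNormedSpace e * (2 * Real.sqrt (Fintype.card mm)) * (Real.sqrt (Fintype.card mm) * ((3 ^ (d + 1) * (72 * ((d : ℝ) + 1) ^ 2 + 9 * ((d : ℝ) + 1)) + (2 + 2 * Real.exp 1 + 2 * Real.exp 1 ^ 2 * ((d : ℝ) + 1))) * (rA * ((((L ^ kk : ℕ) : ℝ))⁻¹))))) + 2 * ((1 + Fintype.card ι * (@basisConst ι _ (Matrix mm mm ℂ) Matrix.frobeniusNormedAddCommGroup Matrix.frobeniusNormedSpace e * (2 * Real.sqrt (Fintype.card mm)) * (Real.sqrt (Fintype.card mm) * (2 * (rA * ((((L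 ^ kk : ℕ) : ℝ))⁻¹)))))) ^ ((d + 2) * L ^ kk)) / (L ^ kk : ℕ)) * (2 + ((1 + Fintype.card ι * (@basisConst ι _ (Matrix mm mm ℂ) Matrix.frobeniusNormedAddCommGroup Matrix.frobeniusNormedSpace e * (2 * Real.sqrt (Fintype.card mm)) * (Real.sqrt (Fintype.card mm) * (2 * (rA * ((((L ^ kk : ℕ) : ℝ))⁻¹)))))) ^ ((d + 2) * L ^ kk) - 1) + ((1 + Fintype.card ι * (@basisConst ι _ (Matrix mm mm ℂ) Matrix.frobeniusNormedAddCommGroup Matrix.frobeniusNormedSpace e * (2 * Real.sqrt (Fintype.card mm)) * (Real.sqrt (Fintype.card mm) * (2 * (rA * ((((L ^ r * L ^ kk : ℕ) : ℝ))⁻¹)))))) ^ ((d + 2) * (L ^ r * L ^ kk)) - 1))) *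
            Real.exp (-(m * (unitTorusGeo L kk (cvM d L mv kk hL)).dist y y')) + oR * Real.exp (-(m * (unitTorusGeo L kk (cvM d L mv kk hL)).dist y y'))
        ≤ rr * ((L ^ kk : ℕ) : ℝ) ^ (-((1 / 8 : ℝ) / 2)) * Real.exp (-(m * (unitTorusGeo L kk (cvM d L mv kk hL)).dist y y')) + (R₁ * (20 * ((((L ^ kk : ℕ) : ℝ))⁻¹) + 4 * Fintype.card ι * (@basisConst ι _ (Matrix mm mm ℂ) Matrix.frobeniusNormedAddCommGroup Matrix.frobeniusNormedSpace e * (2 * Real.sqrt (Fintype.card mm)) * (Real.sqrt (Fintype.card mm) * ((3 ^ (d + 1) * (72 * ((d : ℝ) + 1) ^ 2 + 9 * ((d : ℝ) + 1)) + (2 + 2 * Real.exp 1 + 2 * Real.exp 1 ^ 2 * ((d : ℝ) + 1))) * (rA * ((((L ^ kk : ℕ) : ℝ))⁻¹))))))) * Real.exp (-(m * (unitTorusGeo L kk (cvM d L mv kk hL)).dist y y')) + oR * Real.exp (-(m * (unitTorusGeo L kk (cvM d L mv kk hL)).dist y y')) :=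
          add_le_add (add_le_add (mul_le_mul_of_nonneg_left he1 hrr0) (mul_le_mul_of_nonneg_right hconstD he0)) le_rfl
      _ = _ := by ring
  have hrrN0 : 0 ≤ rr * ((L ^ kk : ℕ) : ℝ) ^ (-((1 / 8 : ℝ) / 2)) + (R₁ * (20 * ((((L ^ kk : ℕ) : ℝ))⁻¹) + 4 * Fintype.card ι * (@basisConst ι _ (Matrix mm mm ℂ) Matrix.frobeniusNormedAddCommGroup Matrix.frobeniusNormedSpace e * (2 * Real.sqrt (Fintype.card mm)) * (Real.sqrt (Fintype.card mm) * ((3 ^ (d + 1) * (72 * ((d : ℝ) + 1) ^ 2 + 9 * ((d : ℝ) + 1)) + (2 + 2 * Real.exp 1 + 2 * Real.exp 1 ^ 2 * ((d : ℝ) + 1))) * (rA * ((((L ^ kk : ℕ) : ℝ))⁻¹))))))) + oR := add_nonneg (add_nonneg hrr0 hON0) hoR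
  -- the two compositions at half the master rate
  have htri := triangle254_unitTorusGeo L kk (cvM d L mv kk hL)
  have hdist := unitTorusGeo_dist_nonneg L kk (cvM d L mv kk hL)
  have hrow := rowSum_unitTorusGeo L kk (cvM d L mv kk hL) (half_pos hm0)
  have hcP0 : 0 ≤ cN + 2 * R₁ + ρR := add_nonneg (by positivity) hρR
  have hA := hasMaj_comp_exp (ρ := m / 2) (σ := m / 2) htri hdist hrow hcP0 hDa0 (by positivity) (by linarith) (by linarith) hP'ι key0'
  have hB := hasMaj_comp_exp (ρ := m / 2) (σ := m / 2) htri hdist hrow hrrN0 hBb.le (by positivity) (by linarith) (by linarith) hDι hG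
  refine ((hA.add hB).neg).mono fun y y' => ?_
  have hκ : (BlockNorm.ofBlocks (unitTorusGeo L kk (cvM d L mv kk hL)) (liftBlk (cvBlk d L mv kk hL ∘ kingPrV L kk r (cvM d L mv kk hL)) ι)).κ = 1 := rfl
  have hκ' : (CvNorm d L mv kk hL ι).κ = 1 := rfl
  rw [hκ, hκ']
  have hexp16 : (((L ^ kk : ℕ) : ℝ)) ^ (-((1 / 8 : ℝ) / 2)) = (((L ^ kk : ℕ) : ℝ)) ^ (-(1 / 16 : ℝ)) := by norm_num
  rw [hexp16]
  have hE0 : 0 ≤ Real.exp (-(m / 2 * (unitTorusGeo L kk (cvM d L mv kk hL)).dist y y')) := Real.exp_nonneg _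
  have hx1 : (((L ^ kk : ℕ) : ℝ)) ^ (-(1 / 16 : ℝ)) ≤ ((((L ^ kk : ℕ) : ℝ)) ^ (-(1 / 16 : ℝ)) + ((14 * Real.exp 1 * (1 + Fintype.card (Fin (d + 1))) * basisConst e * ((1 + Fintype.card (Fin (d + 1))) * ((3 + 2 * ((d : ℝ) + 1)) * rA))) * (1 + Fintype.card (Fin (d + 1) ⊕ Fin (d + 1))) * ((((L ^ kk : ℕ) : ℝ))⁻¹) + 2 * (R₁ * (20 * ((((L ^ kk : ℕ) : ℝ))⁻¹) + 4 * Fintype.card ι * (@basisConst ι _ (Matrix mm mm ℂ) Matrix.frobeniusNormedAddCommGroup Matrix.frobeniusNormedSpace e * (2 * Real.sqrt (Fintype.card mm)) * (Real.sqrt (Fintype.card mm) * ((3 ^ (d + 1) * (72 * ((d : ℝ) + 1) ^ 2 + 9 * ((d : ℝ) + 1)) + (2 + 2 * Real.exp 1 + 2 * Real.exp 1 ^ 2 * ((d : ℝ) + 1))) * (rA * ((((L ^ kk : ℕ) : ℝ))⁻¹))))))) + (oR + oR))) := by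
    have : 0 ≤ (14 * Real.exp 1 * (1 + Fintype.card (Fin (d + 1))) * basisConst e * ((1 + Fintype.card (Fin (d + 1))) * ((3 + 2 * ((d : ℝ) + 1)) * rA))) * (1 + Fintype.card (Fin (d + 1) ⊕ Fin (d + 1))) * ((((L ^ kk : ℕ) : ℝ))⁻¹) + 2 * (R₁ * (20 * ((((L ^ kk : ℕ) : ℝ))⁻¹) + 4 * Fintype.card ι * (@basisConst ι _ (Matrix mm mm ℂ) Matrix.frobeniusNormedAddCommGroup Matrix.frobeniusNormedSpace e * (2 * Real.sqrt (Fintype.card mm)) * (Real.sqrt (Fintype.card mm) * ((3 ^ (d + 1) * (72 * ((d : ℝ) + 1) ^ 2 + 9 * ((d : ℝ) + 1)) + (2 + 2 * Real.exp 1 + 2 * Real.exp 1 ^ 2 * ((d : ℝ) + 1))) * (rA * ((((L ^ kk : ℕ) : ℝ))⁻¹))))))) + (oR + oR) := add_nonneg (by positivity) (add_nonneg hoR hoR)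
    linarith
  have hx2 : (R₁ * (20 * ((((L ^ kk : ℕ) : ℝ))⁻¹) + 4 * Fintype.card ι * (@basisConst ι _ (Matrix mm mm ℂ) Matrix.frobeniusNormedAddCommGroup Matrix.frobeniusNormedSpace e * (2 * Real.sqrt (Fintype.card mm)) * (Real.sqrt (Fintype.card mm) * ((3 ^ (d + 1) * (72 * ((d : ℝ) + 1) ^ 2 + 9 * ((d : ℝ) + 1)) + (2 + 2 * Real.exp 1 + 2 * Real.exp 1 ^ 2 * ((d : ℝ) + 1))) * (rA * ((((L ^ kk : ℕ) : ℝ))⁻¹))))))) ≤ ((((L ^ kk : ℕ) : ℝ)) ^ (-(1 / 16 : ℝ)) + ((14 * Real.exp 1 * (1 + Fintype.card (Fin (d + 1))) * basisConst e * ((1 + Fintype.card (Fin (d + 1))) * ((3 + 2 * ((d : ℝ) + 1)) * rA))) * (1 + Fintype.card (Fin (d + 1) ⊕ Fin (d + 1))) * ((((L ^ kk : ℕ) : ℝ))⁻¹) + 2 * (R₁ * (20 * ((((L ^ kk : ℕ) : ℝ))⁻¹) + 4 * Fintype.card ι * (@basisConst ι _ (Matrix mm mm ℂ) Matrix.frobeniusNormedAddCommGroup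 Matrix.frobeniusNormedSpace e * (2 * Real.sqrt (Fintype.card mm)) * (Real.sqrt (Fintype.card mm) * ((3 ^ (d + 1) * (72 * ((d : ℝ) + 1) ^ 2 + 9 * ((d : ℝ) + 1)) + (2 + 2 * Real.exp 1 + 2 * Real.exp 1 ^ 2 * ((d : ℝ) + 1))) * (rA * ((((L ^ kk : ℕ) : ℝ))⁻¹))))))) + (oR + oR))) := by
    have : 0 ≤ (14 * Real.exp 1 * (1 + Fintype.card (Fin (d + 1))) * basisConst e * ((1 + Fintype.card (Fin (d + 1))) * ((3 + 2 * ((d : ℝ) + 1)) * rA))) * (1 + Fintype.card (Fin (d + 1) ⊕ Fin (d + 1))) * ((((L ^ kk : ℕ) : ℝ))⁻¹) := by positivity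
    linarith [hoR]
  have hx3 : oR ≤ ((((L ^ kk : ℕ) : ℝ)) ^ (-(1 / 16 : ℝ)) + ((14 * Real.exp 1 * (1 + Fintype.card (Fin (d + 1))) * basisConst e * ((1 + Fintype.card (Fin (d + 1))) * ((3 + 2 * ((d : ℝ) + 1)) * rA))) * (1 + Fintype.card (Fin (d + 1) ⊕ Fin (d + 1))) * ((((L ^ kk : ℕ) : ℝ))⁻¹) + 2 * (R₁ * (20 * ((((L ^ kk : ℕ) : ℝ))⁻¹) + 4 * Fintype.card ι * (@basisConst ι _ (Matrix mm mm ℂ) Matrix.frobeniusNormedAddCommGroup Matrix.frobeniusNormedSpace e * (2 * Real.sqrt (Fintype.card mm)) * (Real.sqrt (Fintype.card mm) * ((3 ^ (d + 1) * (72 * ((d : ℝ) + 1) ^ 2 + 9 * ((d : ℝ) + 1)) + (2 + 2 * Real.exp 1 + 2 * Real.exp 1 ^ 2 * ((d : ℝ) + 1))) * (rA * ((((L ^ kk : ℕ) : ℝ))⁻¹))))))) + (oR + oR))) := by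
    have : 0 ≤ (14 * Real.exp 1 * (1 + Fintype.card (Fin (d + 1))) * basisConst e * ((1 + Fintype.card (Fin (d + 1))) * ((3 + 2 * ((d : ℝ) + 1)) * rA))) * (1 + Fintype.card (Fin (d + 1) ⊕ Fin (d + 1))) * ((((L ^ kk : ℕ) : ℝ))⁻¹) := by positivity
    linarith [Real.rpow_nonneg hkpos.le (-(1 / 16 : ℝ)), hON0, hoR]
  have hKKR : 0 ≤ R₁ * (((1 + Fintype.card ι * (@basisConst ι _ (Matrix mm mm ℂ) Matrix.frobeniusNormedAddCommGroup Matrix.frobeniusNormedSpace e * (2 * Real.sqrt (Fintype.card mm)) * (Real.sqrt (Fintype.card mm) * (2 * (rA * ((((L ^ kk : ℕ) : ℝ))⁻¹)))))) ^ ((d + 2) * L ^ kk) - 1) + ((1 + Fintype.card ι * (@basisConst ι _ (Matrix mm mm ℂ) Matrix.frobeniusNormedAddCommGroup Matrix.frobeniusNormedSpace e * (2 * Real.sqrt (Fintype.card mm)) * (Real.sqrt (Fintype.card mm) * (2 * (rA * ((((L ^ r * L ^ kk : ℕ) : ℝ))⁻¹)))))) ^ ((d + 2) * (L ^ r * L ^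 kk)) - 1)) := mul_nonneg hR₁0.le hKK0
  have hρθ : ρR ≤ min θa θb := by linarith [hθle, hKKR]
  have hkey : rr * (((L ^ kk : ℕ) : ℝ)) ^ (-(1 / 16 : ℝ)) + (R₁ * (20 * ((((L ^ kk : ℕ) : ℝ))⁻¹) + 4 * Fintype.card ι * (@basisConst ι _ (Matrix mm mm ℂ) Matrix.frobeniusNormedAddCommGroup Matrix.frobeniusNormedSpace e * (2 * Real.sqrt (Fintype.card mm)) * (Real.sqrt (Fintype.card mm) * ((3 ^ (d + 1) * (72 * ((d : ℝ) + 1) ^ 2 + 9 * ((d : ℝ) + 1)) + (2 + 2 * Real.exp 1 + 2 * Real.exp 1 ^ 2 * ((d : ℝ) + 1))) * (rA * ((((L ^ kk : ℕ) : ℝ))⁻¹))))))) + oR ≤ (rr + 2) * ((((L ^ kk : ℕ) : ℝ)) ^ (-(1 / 16 : ℝ)) + ((14 * Real.exp 1 * (1 + Fintype.card (Fin (d + 1))) * basisConst e * ((1 + Fintype.card (Fin (d + 1))) * ((3 + 2 * ((d : ℝ) + 1)) * rA))) * (1 + Fintype.card (Fin (d + 1) ⊕ Fin (d + 1))) * ((((L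 ^ kk : ℕ) : ℝ))⁻¹) + 2 * (R₁ * (20 * ((((L ^ kk : ℕ) : ℝ))⁻¹) + 4 * Fintype.card ι * (@basisConst ι _ (Matrix mm mm ℂ) Matrix.frobeniusNormedAddCommGroup Matrix.frobeniusNormedSpace e * (2 * Real.sqrt (Fintype.card mm)) * (Real.sqrt (Fintype.card mm) * ((3 ^ (d + 1) * (72 * ((d : ℝ) + 1) ^ 2 + 9 * ((d : ℝ) + 1)) + (2 + 2 * Real.exp 1 + 2 * Real.exp 1 ^ 2 * ((d : ℝ) + 1))) * (rA * ((((L ^ kk : ℕ) : ℝ))⁻¹))))))) + (oR + oR))) := by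
    have h := mul_le_mul_of_nonneg_left hx1 hrr.le
    linarith [hx2, hx3]
  have hkey' : (rr * (((L ^ kk : ℕ) : ℝ)) ^ (-(1 / 16 : ℝ)) + (R₁ * (20 * ((((L ^ kk : ℕ) : ℝ))⁻¹) + 4 * Fintype.card ι * (@basisConst ι _ (Matrix mm mm ℂ) Matrix.frobeniusNormedAddCommGroup Matrix.frobeniusNormedSpace e * (2 * Real.sqrt (Fintype.card mm)) * (Real.sqrt (Fintype.card mm) * ((3 ^ (d + 1) * (72 * ((d : ℝ) + 1) ^ 2 + 9 * ((d : ℝ) + 1)) + (2 + 2 * Real.exp 1 + 2 * Real.exp 1 ^ 2 * ((d : ℝ) + 1))) * (rA * ((((L ^ kk : ℕ) : ℝ))⁻¹))))))) + oR) * Bb * cr ≤ (rr + 2) * Bb * cr * ((((L ^ kk : ℕ) : ℝ)) ^ (-(1 / 16 : ℝ)) + ((14 * Real.exp 1 * (1 + Fintype.card (Fin (d + 1))) * basisConst e * ((1 + Fintype.card (Fin (d + 1))) * ((3 + 2 * ((d : ℝ) + 1)) * rA))) * (1 + Fintype.card (Fin (d + 1) ⊕ Fin (d + 1))) * ((((L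 ^ kk : ℕ) : ℝ))⁻¹) + 2 * (R₁ * (20 * ((((L ^ kk : ℕ) : ℝ))⁻¹) + 4 * Fintype.card ι * (@basisConst ι _ (Matrix mm mm ℂ) Matrix.frobeniusNormedAddCommGroup Matrix.frobeniusNormedSpace e * (2 * Real.sqrt (Fintype.card mm)) * (Real.sqrt (Fintype.card mm) * ((3 ^ (d + 1) * (72 * ((d : ℝ) + 1) ^ 2 + 9 * ((d : ℝ) + 1)) + (2 + 2 * Real.exp 1 + 2 * Real.exp 1 ^ 2 * ((d : ℝ) + 1))) * (rA * ((((L ^ kk : ℕ) : ℝ))⁻¹))))))) + (oR + oR))) := by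
    have h := mul_le_mul_of_nonneg_right (mul_le_mul_of_nonneg_right hkey hBb.le) hcr0
    linarith [show (rr + 2) * ((((L ^ kk : ℕ) : ℝ)) ^ (-(1 / 16 : ℝ)) + ((14 * Real.exp 1 * (1 + Fintype.card (Fin (d + 1))) * basisConst e * ((1 + Fintype.card (Fin (d + 1))) * ((3 + 2 * ((d : ℝ) + 1)) * rA))) * (1 + Fintype.card (Fin (d + 1) ⊕ Fin (d + 1))) * ((((L ^ kk : ℕ) : ℝ))⁻¹) + 2 * (R₁ * (20 * ((((L ^ kk : ℕ) : ℝ))⁻¹) + 4 * Fintype.card ι * (@basisConst ι _ (Matrix mm mm ℂ) Matrix.frobeniusNormedAddCommGroup Matrix.frobeniusNormedSpace e * (2 * Real.sqrt (Fintype.card mm)) * (Real.sqrt (Fintype.card mm) * ((3 ^ (d + 1) * (72 * ((d : ℝ) + 1) ^ 2 + 9 * ((d : ℝ) + 1)) + (2 + 2 * Real.exp 1 + 2 * Real.exp 1 ^ 2 * ((d : ℝ) + 1))) * (rA * ((((L ^ kk : ℕ) : ℝ))⁻¹))))))) + (oR + oR))) * Bb * cr = (rr + 2) * Bb * cr * ((((L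 ^ kk : ℕ) : ℝ)) ^ (-(1 / 16 : ℝ)) + ((14 * Real.exp 1 * (1 + Fintype.card (Fin (d + 1))) * basisConst e * ((1 + Fintype.card (Fin (d + 1))) * ((3 + 2 * ((d : ℝ) + 1)) * rA))) * (1 + Fintype.card (Fin (d + 1) ⊕ Fin (d + 1))) * ((((L ^ kk : ℕ) : ℝ))⁻¹) + 2 * (R₁ * (20 * ((((L ^ kk : ℕ) : ℝ))⁻¹) + 4 * Fintype.card ι * (@basisConst ι _ (Matrix mm mm ℂ) Matrix.frobeniusNormedAddCommGroup Matrix.frobeniusNormedSpace e * (2 * Real.sqrt (Fintype.card mm)) * (Real.sqrt (Fintype.card mm) * ((3 ^ (d + 1) * (72 * ((d : ℝ) + 1) ^ 2 + 9 * ((d : ℝ) + 1)) + (2 + 2 * Real.exp 1 + 2 * Real.exp 1 ^ 2 * ((d : ℝ) + 1))) * (rA * ((((L ^ kk : ℕ) : ℝ))⁻¹))))))) + (oR + oR))) by ring]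
  have hT1 : (cN + 2 * R₁ + ρR) * max Da 0 * cr * ((((L ^ kk : ℕ) : ℝ)) ^ (-(1 / 16 : ℝ)) + ((14 * Real.exp 1 * (1 + Fintype.card (Fin (d + 1))) * basisConst e * ((1 + Fintype.card (Fin (d + 1))) * ((3 + 2 * ((d : ℝ) + 1)) * rA))) * (1 + Fintype.card (Fin (d + 1) ⊕ Fin (d + 1))) * ((((L ^ kk : ℕ) : ℝ))⁻¹) + 2 * (R₁ * (20 * ((((L ^ kk : ℕ) : ℝ))⁻¹) + 4 * Fintype.card ι * (@basisConst ι _ (Matrix mm mm ℂ) Matrix.frobeniusNormedAddCommGroup Matrix.frobeniusNormedSpace e * (2 * Real.sqrt (Fintype.card mm)) * (Real.sqrt (Fintype.card mm) * ((3 ^ (d + 1) * (72 * ((d : ℝ) + 1) ^ 2 + 9 * ((d : ℝ) + 1)) + (2 + 2 * Real.exp 1 + 2 * Real.exp 1 ^ 2 * ((d : ℝ) + 1))) * (rA * ((((L ^ kk : ℕ) : ℝ))⁻¹))))))) + (oR + oR))) ≤ (cN + 2 * R₁ + min θa θb) * max Da 0 * cr * ((((L ^ kk : ℕ) : ℝ))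 ^ (-(1 / 16 : ℝ)) + ((14 * Real.exp 1 * (1 + Fintype.card (Fin (d + 1))) * basisConst e * ((1 + Fintype.card (Fin (d + 1))) * ((3 + 2 * ((d : ℝ) + 1)) * rA))) * (1 + Fintype.card (Fin (d + 1) ⊕ Fin (d + 1))) * ((((L ^ kk : ℕ) : ℝ))⁻¹) + 2 * (R₁ * (20 * ((((L ^ kk : ℕ) : ℝ))⁻¹) + 4 * Fintype.card ι * (@basisConst ι _ (Matrix mm mm ℂ) Matrix.frobeniusNormedAddCommGroup Matrix.frobeniusNormedSpace e * (2 * Real.sqrt (Fintype.card mm)) * (Real.sqrt (Fintype.card mm) * ((3 ^ (d + 1) * (72 * ((d : ℝ) + 1) ^ 2 + 9 * ((d : ℝ) + 1)) + (2 + 2 * Real.exp 1 + 2 * Real.exp 1 ^ 2 * ((d : ℝ) + 1))) * (rA * ((((L ^ kk : ℕ) : ℝ))⁻¹))))))) + (oR + oR))) :=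
    mul_le_mul_of_nonneg_right (mul_le_mul_of_nonneg_right (mul_le_mul_of_nonneg_right (by linarith [hρθ]) (le_max_right _ _)) hcr0) hX0
  calc 1 * (cN + 2 * R₁ + ρR) * (max Da 0 * ((((L ^ kk : ℕ) : ℝ)) ^ (-(1 / 16 : ℝ)) + ((14 * Real.exp 1 * (1 + Fintype.card (Fin (d + 1))) * basisConst e * ((1 + Fintype.card (Fin (d + 1))) * ((3 + 2 * ((d : ℝ) + 1)) * rA))) * (1 + Fintype.card (Fin (d + 1) ⊕ Fin (d + 1))) * ((((L ^ kk : ℕ) : ℝ))⁻¹) + 2 * (R₁ * (20 * ((((L ^ kk : ℕ) : ℝ))⁻¹) + 4 * Fintype.card ι * (@basisConst ι _ (Matrix mm mm ℂ) Matrix.frobeniusNormedAddCommGroup Matrix.frobeniusNormedSpace e * (2 * Real.sqrt (Fintype.card mm)) * (Real.sqrt (Fintype.card mm) * ((3 ^ (d + 1) * (72 * ((d : ℝ) + 1) ^ 2 + 9 * ((d : ℝ) + 1)) + (2 + 2 * Real.exp 1 + 2 * Real.exp 1 ^ 2 * ((d : ℝ) + 1))) * (rA * ((((L ^ kk : ℕ)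 : ℝ))⁻¹))))))) + (oR + oR)))) * cr * Real.exp (-(m / 2 * (unitTorusGeo L kk (cvM d L mv kk hL)).dist y y')) +
        1 * (rr * (((L ^ kk : ℕ) : ℝ)) ^ (-(1 / 16 : ℝ)) + (R₁ * (20 * ((((L ^ kk : ℕ) : ℝ))⁻¹) + 4 * Fintype.card ι * (@basisConst ι _ (Matrix mm mm ℂ) Matrix.frobeniusNormedAddCommGroup Matrix.frobeniusNormedSpace e * (2 * Real.sqrt (Fintype.card mm)) * (Real.sqrt (Fintype.card mm) * ((3 ^ (d + 1) * (72 * ((d : ℝ) + 1) ^ 2 + 9 * ((d : ℝ) + 1)) + (2 + 2 * Real.exp 1 + 2 * Real.exp 1 ^ 2 * ((d : ℝ) + 1))) * (rA * ((((L ^ kk : ℕ) : ℝ))⁻¹))))))) + oR) * Bb * cr * Real.exp (-(m / 2 * (unitTorusGeo L kk (cvM d L mv kk hL)).dist y y'))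
      = ((cN + 2 * R₁ + ρR) * max Da 0 * cr * ((((L ^ kk : ℕ) : ℝ)) ^ (-(1 / 16 : ℝ)) + ((14 * Real.exp 1 * (1 + Fintype.card (Fin (d + 1))) * basisConst e * ((1 + Fintype.card (Fin (d + 1))) * ((3 + 2 * ((d : ℝ) + 1)) * rA))) * (1 + Fintype.card (Fin (d + 1) ⊕ Fin (d + 1))) * ((((L ^ kk : ℕ) : ℝ))⁻¹) + 2 * (R₁ * (20 * ((((L ^ kk : ℕ) : ℝ))⁻¹) + 4 * Fintype.card ι * (@basisConst ι _ (Matrix mm mm ℂ) Matrix.frobeniusNormedAddCommGroup Matrix.frobeniusNormedSpace e * (2 * Real.sqrt (Fintype.card mm)) * (Real.sqrt (Fintype.card mm) * ((3 ^ (d + 1) * (72 * ((d : ℝ) + 1) ^ 2 + 9 * ((d : ℝ) + 1)) + (2 + 2 * Real.exp 1 + 2 * Real.exp 1 ^ 2 * ((d : ℝ) + 1))) * (rA * ((((L ^ kk : ℕ) : ℝ))⁻¹))))))) + (oR + oR))) + (rr * (((L ^ kk : ℕ) : ℝ)) ^ (-(1 / 16 : ℝ)) + (R₁ * (20 * ((((L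 ^ kk : ℕ) : ℝ))⁻¹) + 4 * Fintype.card ι * (@basisConst ι _ (Matrix mm mm ℂ) Matrix.frobeniusNormedAddCommGroup Matrix.frobeniusNormedSpace e * (2 * Real.sqrt (Fintype.card mm)) * (Real.sqrt (Fintype.card mm) * ((3 ^ (d + 1) * (72 * ((d : ℝ) + 1) ^ 2 + 9 * ((d : ℝ) + 1)) + (2 + 2 * Real.exp 1 + 2 * Real.exp 1 ^ 2 * ((d : ℝ) + 1))) * (rA * ((((L ^ kk : ℕ) : ℝ))⁻¹))))))) + oR) * Bb * cr) *
          Real.exp (-(m / 2 * (unitTorusGeo L kk (cvM d L mv kk hL)).dist y y')) := by ring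
    _ ≤ ((cN + 2 * R₁ + min θa θb) * max Da 0 * cr * ((((L ^ kk : ℕ) : ℝ)) ^ (-(1 / 16 : ℝ)) + ((14 * Real.exp 1 * (1 + Fintype.card (Fin (d + 1))) * basisConst e * ((1 + Fintype.card (Fin (d + 1))) * ((3 + 2 * ((d : ℝ) + 1)) * rA))) * (1 + Fintype.card (Fin (d + 1) ⊕ Fin (d + 1))) * ((((L ^ kk : ℕ) : ℝ))⁻¹) + 2 * (R₁ * (20 * ((((L ^ kk : ℕ) : ℝ))⁻¹) + 4 * Fintype.card ι * (@basisConst ι _ (Matrix mm mm ℂ) Matrix.frobeniusNormedAddCommGroup Matrix.frobeniusNormedSpace e * (2 * Real.sqrt (Fintype.card mm)) * (Real.sqrt (Fintype.card mm) * ((3 ^ (d + 1) * (72 * ((d : ℝ) + 1) ^ 2 + 9 * ((d : ℝ) + 1)) + (2 + 2 * Real.exp 1 + 2 * Real.exp 1 ^ 2 * ((d : ℝ) + 1))) * (rA * ((((L ^ kk : ℕ) : ℝ))⁻¹))))))) + (oR + oR))) + (rr + 2) * Bb * cr * ((((L ^ kk : ℕ) : ℝ)) ^ (-(1 / 16 :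 ℝ)) + ((14 * Real.exp 1 * (1 + Fintype.card (Fin (d + 1))) * basisConst e * ((1 + Fintype.card (Fin (d + 1))) * ((3 + 2 * ((d : ℝ) + 1)) * rA))) * (1 + Fintype.card (Fin (d + 1) ⊕ Fin (d + 1))) * ((((L ^ kk : ℕ) : ℝ))⁻¹) + 2 * (R₁ * (20 * ((((L ^ kk : ℕ) : ℝ))⁻¹) + 4 * Fintype.card ι * (@basisConst ι _ (Matrix mm mm ℂ) Matrix.frobeniusNormedAddCommGroup Matrix.frobeniusNormedSpace e * (2 * Real.sqrt (Fintype.card mm)) * (Real.sqrt (Fintype.card mm) * ((3 ^ (d + 1) * (72 * ((d : ℝ) + 1) ^ 2 + 9 * ((d : ℝ) + 1)) + (2 + 2 * Real.exp 1 + 2 * Real.exp 1 ^ 2 * ((d : ℝ) + 1))) * (rA * ((((L ^ kk : ℕ) : ℝ))⁻¹))))))) + (oR + oR)))) * Real.exp (-(m / 2 * (unitTorusGeo L kk (cvM d L mv kk hL)).dist y y')) :=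
        mul_le_mul_of_nonneg_right (add_le_add hT1 hkey') hE0
    _ = cr * ((cN + 2 * R₁ + min θa θb) * max Da 0 + (rr + 2) * Bb) * ((((L ^ kk : ℕ) : ℝ)) ^ (-(1 / 16 : ℝ)) + ((14 * Real.exp 1 * (1 + Fintype.card (Fin (d + 1))) * basisConst e * ((1 + Fintype.card (Fin (d + 1))) * ((3 + 2 * ((d : ℝ) + 1)) * rA))) * (1 + Fintype.card (Fin (d + 1) ⊕ Fin (d + 1))) * ((((L ^ kk : ℕ) : ℝ))⁻¹) + 2 * (R₁ * (20 * ((((L ^ kk : ℕ) : ℝ))⁻¹) + 4 * Fintype.card ι * (@basisConst ι _ (Matrix mm mm ℂ) Matrix.frobeniusNormedAddCommGroup Matrix.frobeniusNormedSpace e * (2 * Real.sqrt (Fintype.card mm)) * (Real.sqrt (Fintype.card mm) * ((3 ^ (d + 1) * (72 * ((d : ℝ) + 1) ^ 2 + 9 * ((d : ℝ) + 1)) + (2 + 2 * Real.exp 1 + 2 * Real.exp 1 ^ 2 * ((d : ℝ) + 1))) * (rA * ((((L ^ kk : ℕ) : ℝ))⁻¹))))))) + (oR + oR))) * Real.exp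 (-(m / 2 * (unitTorusGeo L kk (cvM d L mv kk hL)).dist y y')) := by ring

end Lap

end Summit.QuantumFields.YangMills.BalabanUVNodes.N15.Gluing

end
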